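import Summits.SmoothPoincare4.SmoothPoincare4.Theses.EntropyRung
import Literature.Geometry.Riemannian.ShrinkingRoundSphereFour
import Literature.Geometry.Riemannian.GaussianShrinker
import Literature.Geometry.Riemannian.RicciFlowScalarMaximumPrinciple
import Literature.Geometry.Riemannian.PerelmanEntropyCutoff

/-!
# Disproof of `CompactShrinkerGap` — findings (cdisprove, gen 5, v10; v1–v7 gens 1–3, v8–v9 gen 4)

Crux `EntropyRung.CompactShrinkerGap` (item stmt-SmoothPoincare4-10870): for a closed smooth
`M ≃ₕ S⁴`, a Riemannian `g` with Levi-Civita connection and a smooth `f` with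
`Ric + Hess f = g/2`, `R + |∇f|² = f` and `32π²√π e^{-3/2} < ∫ e^{-f} dV`
(Gaussian density `Θ > Θ(S³×ℝ) ≈ .791`) one has `M ≅ S⁴` (C^∞ diffeomorphism).

FINDINGS (everything below is kernel-checked unless marked PAPER):

* §0 `spc4_implies`, `not_compactShrinkerGap_imp_not_spc4` — the crux is a COROLLARY of the summit;
  a refutation exhibits an exotic smooth homotopy 4-sphere (carrying a dense shrinker). So the crux
  is not refutable short of `¬ SPC4`; the standing adversary can only attack natural
  strengthenings, drops of hypotheses, and the lines' transfer targets.
* §1 `hyps_round` — NON-VACUITY: `(S⁴ ⊂ ℝ⁵, 6·g_rd, f ≡ 2)` satisfies all four typed hypotheses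
  (`Ric = g/2`, `R = 2 = f`, `Hess 2 = 0`, `|∇2|² = 0`, `∫ e^{-2} dV = 96π² e^{-2} > 32π²√π e^{-3/2}`);
  `conclusion_round` — and the conclusion (refl). `density_ratio_window` — TIGHTNESS: the round
  sphere clears the bar by a factor in `(1.026, 1.027)` only (`Θ(S⁴)/Θ(S³×ℝ) = 3/(√π e^{1/2})`).
* §2 `compactShrinkerGap_iff_noCompactBinder` — `[CompactSpace M]` is a REDUNDANT binder
  (derivable from `M ≃ₕ S⁴`, Hatcher 3.29 in tree); information only.
* §3 `withoutCompactHomotopy_false` — dropping `M ≃ₕ S⁴` together with compactness is FALSE in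
  Lean: the Gaussian shrinker `(ℝ⁴, δ, |x|²/4)` has `Θ = 1 > .791` and `ℝ⁴ ≇ S⁴`. PAPER: the bound
  is moreover SHARP among non-flat non-compact shrinkers — `S³(2)×ℝ ≅ (ℝ⁴∖0, 4|x|⁻²δ)`,
  `f = log²|x| + 3/2`, has `∫ e^{-f} dV = 16π² · 2√π · e^{-3/2}` exactly (`cylinder_weightedVolume`).
* §4 `WithoutHomotopy` (keep compactness, drop `M ≃ₕ S⁴`): OPEN in the connected case = the
  Cao–Hamilton–Ilmanen expectation that `S⁴` is the densest compact non-flat 4-d shrinker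
  (densest known competitor `ℂP²`, `Θ = 9/(2e²) = .609`); FALSE only by the DISCONNECTED
  `S⁴(√6) ⊔ S⁴(√6)` — `sum_sphereFour_not_homeomorphic` + `two_round_gt_threshold` prove
  everything except packaging the metric on `M ⊕ M'` (no Sum-manifold metric in the tree).
* §5 `WithoutDensity` / `WithoutNormalisation` / `WithoutSoliton` / `WithoutSmooth`: each is
  still implied by SPC4 (`spc4_implies_without*`), hence as unrefutable as the crux; PAPER: each
  is in fact EQUIVALENT to SPC4 (every Σ carries a constant-scalar-curvature metric; rescale),
  so the soliton equation AND the density floor are the only hypotheses that could make the crux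
  easier than SPC4 — the live content is a rigidity statement for dense compact shrinkers.
* §6 Jensen volume floor (`lintegral`-free core `integral_exp_neg_le_of_mean_two`): from the
  integrated identity `∫ f e^{-f} = 2 ∫ e^{-f}` (prover input: `Δ_f f = 2 - f`, closed `M`) one gets
  `∫ e^{-f} dV ≤ e^{-2} Vol`, so the density hypothesis forces `Vol_g(M) > 32π²√π e^{1/2} ≈ 923`,
  i.e. `Vol > 0.973 · Vol(S⁴(√6))` (`volume_floor_window`): any counterexample is VOLUME-NEAR-ROUND.
* §8 `DenseShrinkerOnSphereIsEinstein` — the one genuinely falsifiable strengthening (on the STANDARD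
  `S⁴`), recorded as the target for future adversaries; `compactShrinkerGap_on_sphereFour` (crux at
  `M = S⁴` is true outright).
* §9 Koiso–Cao calibration (closed form via Donovan 2025 L5.10): `Θ = .51787` (= CHI), `Vol = 64π²`,
  `D = 58.3`, `f ∈ [1.472, 2.528]` in the crux normalisation — the cgy line's identities check out on
  the one non-Einstein compact example; `f_max ≤ 2.53` on every known compact 4-d shrinker.
* §10 adversarial pass over the three filed Lines (cgy-variance-pivot, decay-climb-numax,
  density-summit-stability): CRZ-sharp bound re-derived (correct), orbifold bound `Θ ≤ 1/|Γ|` and the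
  hidden `sup ν = ν(round)` input examined — no misstatement, no kill.
* §7 Einstein sub-case constants: `gursky_bound_lt_threshold` (`32π² e^{-2} < thr`: a non-round
  Einstein shrinker on a homotopy sphere misses the bar by a factor `2.92`), `half_round_lt_threshold`
  (`48π² e^{-2} < thr`: a free ℤ₂-quotient of the round shrinker misses it too).
* §11 (v6, on the PICKED line cgy-variance-pivot's CRZ sub-line) `potentialLeThree_false_without_compactHomotopy`
  — `f ≤ 3` minus closedness is FALSE (Gaussian shrinker, `f(4e₀) = 4`; `f` is proper on every non-compact
  shrinker), LANDED as `Theorems/CompactShrinkerGap/Negative/PotentialLeThreeWithoutCompactHomotopyFalse.lean`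
  (p71580); the `c = 3.1` arithmetic witness LANDED as `Negative/CrzArithmeticBeyondThreeFalse.lean` (p71615); `two_le_of_potential_le` / `ae_eq_two_of_potential_le_two` — the `f_max` window is `[2, 3]`
  with `f_max = 2` iff Einstein (a.e.), so the sub-line's live range is `f_max = R_max ∈ (2, 3]` (Koiso–Cao
  `2.53`, not dense); `crz_arith_fails_at_exp_3_1` — the three inequalities of `varianceBudget_arith`
  STOP implying the budget at `c = 3.1` (explicit witness; PAPER ceiling `c* = 2 + log(5 − 6/(√π e^{1/2}))
  = 3.0807`): the constant `3` carries `< 3 %` slack, `PotentialLeThree` cannot be relaxed inside the sub-line.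
  v7 NUMERICS: Donovan's orbifold Kähler family (296 compact shrinking soliton orbifolds scanned) has
  `f_max = R_max > 3` in 144 cases and violates STUB 1's raw inequality in 295 — all at `Θ ≤ .34`: `f ≤ 3`
  and the budget are density phenomena or nothing (§11 STATUS block); Koiso–Cao recomputed independently
  (CRZ-sharp loses a factor `3.37`, the sign-kept form `1.20`, §13).
* §12 `einstein_budget_iff`, `budget_fails_at_halfRound`, `jensen_floor_gt_halfRound`,
  `budget_violation_threshold` — STUB 1's raw inequality `D < 2V − 96π²` is NOT a universal compact-shrinker
  inequality: it FAILS (PAPER, `D = 0`) for every Einstein shrinker of `Vol ≤ 48π²` (KE del Pezzo surfaces of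
  degree `≤ 6`, `ℝP⁴(√6)`; equality at `48π²`), all at `Θ ≤ 3/e² = .406`; the density floor excludes them
  only through Jensen (`Vol > 93.5π² > 48π²`), so any proof of STUB 1 must spend the density, and for
  non-Einstein data must bound `D` (mean `(R−2)² ≥ 2 − 96π²/V ≥ .97` is what a violator needs).
* §13 typed audit of the reshaped 7-stub skeleton: `weylEnergy` = `(0,4)`-norm, `σ₂ = −½|E|² + R²/24`, CGB and
  CGY in matching normalisation (calibrated on `ℂP²`, `S²×S²`, Koiso–Cao with `W ≠ 0`); (A), (B), STUB 3's
  constants, STUB 4's minimum-principle argument, `CRZSharpBound` all re-derived — NO misstatement; a sharper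
  paper form of CRZ (`D ≤ ½∫R(2−R)(e^{f_max−f} − 1)`) recorded for the provers.

* §14 (v8, gen 4; LANDED as `Theorems/CompactShrinkerGap/Negative/ScalarToolkitAdmitsViolator.lean`, p74849 accepted)
  `scalarToolkit_witness` / `not_budget_of_scalarToolkit` — the COMPLETE printed scalar toolkit in
  `(V, Z, D, f_max, f_min, R_min)` (density floor, Jensen, `e^{-f_max}V ≤ Z ≤ e^{-f_min}V`, `0 < R_min ≤ f_min < 2
  < f_max`, CRZ coarea bound, CRZ Thm 1, CRZ Thm 2 ⟺ Gursky ⟺ CGB+`∫|W|² ≥ 0`, Catino pinching, Bhatia–Davis) is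
  satisfied by the budget VIOLATOR `(95π², 0.99e^{-2}·95π², 100π², 4, 1, ½)`: STUB 1 is not reachable by scalar
  arithmetic over anything in print; `budget_of_crz_of_fmax_le_three` / `budget_of_bhatiaDavis_of_fmax_le`: the ONE
  missing scalar is `f_max = R_max` (`≤ 3.0807` via CRZ, `≤ 2.4867` via Bhatia–Davis — weaker, and already below
  Koiso–Cao's `2.5276`); `weightedIdentities_cannot_bound_variance`: even with the EXACT weighted identity
  `∫(f−2)e^{-f} = 0`, `∫R = 2V` and the pointwise coupling `0 < R ≤ f`, three-atom volume laws have `D/V ≥ 1/(4m)`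
  unbounded at density slack `2m` — pinning the law of `f` does not pin `R`.
* §15 (v8; LANDED as `Negative/DensityPinning.lean`, p76440 accepted) `volume_superlevel_le` / `volume_sublevel_le` —
  DENSITY PINNING (kernel-checked measure-theoretic core, from
  `∫f e^{-f} = 2∫e^{-f}` + the density floor): with `ε := 1 − e²Z₀/V = 1 − 93.51π²/V`,
  `Vol{f ≥ T}·(1 − (T−1)e^{2−T}) ≤ εV` (`T ≥ 2`) and `Vol{f ≤ t}·(1 − (t−1)e^{2−t}) ≤ εV` (`t ≤ 2`); at the Jensen
  scale `V = 95π²` (`ε = .0157`): `Vol{f ≥ 3} ≤ 5.9 %`, `Vol{f ≥ 4} ≤ 2.6 %`, `Vol{f ≤ 1} ≤ 1.6 %`, `Vol{f ≤ 1.5} ≤ 8.9 %`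
  of `V` — a counterexample/violator is Gaussian-mass-concentrated at `f ≈ 2` yet needs `R_max = f_max > 3.08` and
  `dV`-RMS of `R − 2` above `0.98`: its bulk must be GAUSSIAN-SHELL-like (`R` small, `|∇f|² ≈ 2`), not sphere-like.
* §16 (v8) PAPER/computed: the density table in all dimensions `n ≤ 30` (`Θ(Sⁿ)`, `Θ(S^{n−1}×ℝ)`, `Θ(ℂP^{n/2})`,
  `Θ(S^p×S^q)`): no crossover — the cylinder is always the runner-up among classical shrinkers, the window
  `1 − Θ_cyl/Θ_sph` shrinks `2.6 % (n=4), 1.3 %, .81 %, .55 %, … → 0`; MCF dictionary: every known non-round compact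
  self-shrinker (Angenent torus, Chopp's numerical examples, Drugan's immersed sphere, KKM/Nguyen desingularisations)
  has entropy ABOVE the cylinder's, i.e. is SPARSE in Ricci terms — the analogy predicts exotic compact 4-d Ricci
  shrinkers, if any, at `Θ < .791`, never a counterexample.

* §17 (v9) LP CARTOGRAPHY of violators in the `(V, f_max)` plane (numerics, folder `lp/`, evidence
  `numerics_gen4_lp.txt`, kit j011012 queued): maximising `D/V` over all joint volume laws of `(f, R)` on `{0 ≤ R ≤ f ≤ F}`
  subject to the LINEAR identities a closed shrinker satisfies (C1–C4, W1 `∫|∇f|²e^{-f} = ∫(f−2)²e^{-f}`, W2′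
  `∫(R − R²/2)e^{-f} ≥ ½e^{-f_max}D`, U1 `D = ∫(f−R)(3−R)`, + CRZ) gives `F*(V)` with "`f_max ≤ F*(V)` ⇒ budget" and "violator ⇒
  `f_max > F*(V)`": `F* = ∞ (V ≤ 96π²)`, `10.9 (98π²)`, `8.1 (100π²)`, `5.5 (104π²)`, `4.5 (108π²)`, dip `≈ 3.63` at `V ≈ 128π²`,
  `3.7 (150π²)`, `3.8 (200π²)`, `4.0 (500π²)` — so the CRZ ceiling `3.0807` relaxes to `≈ 3.6` with three M-sized identities, every
  violator has `V > 104π² > Vol(S⁴(√6))`, `R_max = f_max > 3.6`, RMS`(R−2) > 1.04`, and the LP-extremal law at the dip is a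
  forbidden object: a rotational PEANUT (cylindrical body `R ≈ 1.35` on half the volume + caps `R ≈ 3.5`), which Kotschwar's
  theorem excludes among SO(4)-invariant metrics.

* §18 (v9) TYPED PROVER INPUTS `WeightedDirichletIdentity` (W1), `WeightedScalarIdentity` (W2), `VarianceGradientIdentity`
  (U1) — the three M-sized identities behind §17, as `Prop`s in the crux's vocabulary (+ round-model sanity checks), ready to be
  stated as stubs of any line on a promoted `VarianceBudget` crux.

* §19 (v10, gen 5) THE TWO FORMS OF STUB 7 (`f ≤ 3` vs `R ≤ 3`): `forall_scalarCurvature_le_iff_forall_potential_le` (Fermat at a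
  maximum of `f`: `sup R = sup f` on closed normalised shrinkers) ⇒ `potentialLeThree_iff_scalarLeThree` on the crux's binder block;
  but on the sibling crux's block (connected, non-compact, COMPLETE, dense) `potentialLeThreeNoncompact_false` (Gaussian, `f(4e₀) = 4`)
  while `scalarLeThreeNoncompact_of_noncompactShrinkerGap` (dense non-compact ⇒ `R ≡ 0` by stmt-10868). Recommendation: type the sup
  bound as `R ≤ 3`. Landing file `Negative/PotentialVsScalarLeThree.lean` (inlined statements) prepared; gate down at v10 publication.
* §20 (v10) THE TORIC LABORATORY (numerics, pure quadrature of polytope data, five-way validated incl. Koiso–Cao to all digits, FIK `.672`,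
  Gaussian `1`, `ℝ²×S²` `2/e`): Wang–Zhu on `ℂP²#2(−ℂP²)` has `f_max = R_max = 2.8695` (NEW record among smooth compact shrinkers; the
  "`≤ 2.53`" of §9/§11 is superseded), `Θ = .4549`, and satisfies STUB 1 via U1 (`D ≤ 137.3 < 157.9`); all 6429 toric KRS orbifold
  surfaces with small normals obey `Θ ≤ 1/|Γ|`, `f_max` up to `28.7`, densest with `f_max > 3` is `ℂP²_{(1,1,2)}` (`Θ = .430`, `f_max = 3.34`);
  and `Θ(BCCD) = 0.562` for the Bamler–Cifarelli–Conlon–Deruelle shrinker on `Bl_p(ℂ×ℙ¹)` — the last 4-d Kähler shrinker without a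
  computed density, the named risk of stmt-10868 — far below `.791` (closed forms; kernel-checked one-point bounds `bccd_density_lt_bar`,
  `fik_density_lt_bar`).
* §21 (v10) STRUCTURE NOTE (paper): the whole `f`-test-function family collapses to "the law of `f` determines `E[R | f]`" + a no-gap
  constraint; its optimal output is exactly U1's `D ≤ 3∫|∇f|²`; everything sharper (the §17 dip `3.6`) comes from the `R`-family/CRZ.

WHY IT RESISTS (literature, page-verified this cycle unless marked):
* A kill needs an exotic `Σ⁴` carrying a NON-Einstein shrinker with `Θ > .791` (Einstein ones are excluded
  by Gursky 2000 + Hitchin, §7). No compact non-Einstein 4-d shrinker is known on ANY manifold except the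
  Kähler ones — Koiso–Cao on `ℂP²#(−ℂP²)` (`Θ = 3.826/e² = .518`) and Wang–Zhu on `ℂP²#2(−ℂP²)` — and the
  4-d Kähler shrinkers are completely classified (BCCD 2024, quoted in Donovan 2025 p. 4); all have `b₂ ≥ 1`.
  CHI table (arXiv:math/0404165 p. 7): `S⁴ .812 > S³×ℝ .791 > S²×ℝ² .736 > FIK .672 > ℂP² .609 > S²×S² .541
  > Koiso .518 > Page .517 > … `; nothing but `S⁴` is known above the bar even WITHOUT the homotopy hypothesis.
* On `S⁴` itself (where the cards' transfer targets `HighDensityIsEinstein`, `VarianceBudget`,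
  `SummitIsRound`, `GlobalMaxIsStandard` would already be falsified by a dense non-Einstein shrinker):
  rotationally (SO(4)-) invariant shrinkers on `Sⁿ` are round (Kotschwar 2008, arXiv:math/0702597 Thm 1);
  SU(2)-cohomogeneity-one compact shrinkers were searched numerically by Donovan 2025 (arXiv:2503.15033
  §5.2, Conj. 1.5: on `S⁴` only the round metric), SO(3)×SO(2)-invariant ones by Buttsworth 2022 (cited
  ibid.), and the cohomogeneity-one study of Dancer–Hall–Wang 2013 (arXiv:1105.6195 §6.1) recovers only
  Koiso–Cao and Page in the U(2) class on `ℂP²#(−ℂP²)`. An independent biaxial U(2) shooting scan on `S⁴`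
  was run this cycle (folder `u2shoot/`, NOTES §Numerics; kit job j007200 queued for the fine scan) — 41²
  scans of the pole data `(A,B)` on `[−2,2]²`, `[−.35,.25]²`, `[−.06,.03]²` (round `S⁴(√6)` = `(−1/72,−1/72)`;
  `u2scan_summary.txt` attached): the only cells where both equator mismatches `(a′/a, f′)` change sign at
  the maximal orbit are those touching the round point (a nondegenerate isolated root, `|m| ≈ 45·dist`);
  along the SO(4) diagonal `A = B → −∞` the mismatch decays (`|f′| = .012` at `A = B = −1`, `t_eq = 24`) as
  the trajectory hugs the cylinder `a = b = 1` (`S³(2)×ℝ`, the bar itself) — the degenerate neck family,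
  never a compact shrinker; `B ≳ 0.2` always crashes. Asymmetric two-pole closings: kit job pending.
* Quantitative squeeze on a counterexample: `Θ ∈ (.791, ?)`, `Vol > 0.973·Vol(S⁴(√6))` (§6), and by
  Cheng–Ribeiro–Zhou 2023 (arXiv:2203.14916 Thm 2) `Vol·(5 − e^{osc f}) ≤ 384π²` with equality iff
  `S⁴(√6)` — compatible with §6 for every `osc f > 0`, so no contradiction is available from volume alone.
* Every single-hypothesis drop that keeps `M ≃ₕ S⁴` is SPC4-implied (§5): the analytic hypotheses can
  only make the crux EASIER than SPC4; the only falsifiable strengthenings live on the standard `S⁴`.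
* (v6) The MEAN-CURVATURE-FLOW TWIN of the crux — and even of the homotopy-free strengthening
  `WithoutHomotopy` (§4) — is a THEOREM in every dimension: Colding–Ilmanen–Minicozzi–White 2013
  (arXiv:1205.2043, Thm. 1, p. 3, page-read this cycle): "if `Σ ⊂ ℝ^{n+1}` is a closed self-shrinker not
  equal to the round sphere, then `λ(Σ) ≥ λ(Sⁿ) + ε`; moreover, if `λ(Σ) ≤ λ(S^{n−1})` [= `λ(S^{n−1}×ℝ)`],
  then `Σ` is diffeomorphic to `Sⁿ`"; and for arbitrary closed hypersurfaces `Σ³ ⊂ ℝ⁴`, `λ[Σ] ≤ λ[S²×ℝ] ⇒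
  Σ ≅ S³` (Bernstein–Wang, arXiv:1511.00387, Thm. 1.1 p. 3; Thm. 1.5: `n ≥ 4` conditional on two
  low-entropy classification hypotheses) — the exact shape of route EntropyRung. So no counterexample "by
  analogy" is on offer; what the Ricci side lacks is CIMW's input (i), the classification of entropy-stable
  compact shrinkers (Cao's stability conjecture; lines decay-climb-numax / density-summit-stability), not a
  reason to expect a dense exotic shrinker.
* (v9) LITERATURE 2025 (arXiv backend; searchd/zbMATH degraded this session): the newest rigidity theorems for compact 4-d
  shrinkers — X. Cao–Ribeiro–Wondo, arXiv:2509.20669, Thms 2–5 (round `S⁴` or `ℂP²` under POINTWISE pinching of the modified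
  sectional curvature `K̄ ≥ .31` and `S ≥ 3.69` in the `λ = 1` normalisation; weighted Gursky–LeBrun-type gap for `W^±`;
  Hitchin–Thorpe under `K̄ ≥ .186`), building on X. Cao–Tran's Weitzenböck formula for `W⁺` on shrinkers and CRZ — all need
  pointwise curvature pinching; still nothing links `sup R`, `D` or `∫|W|²` to the density `Θ`. Li–Zhang–Zhang arXiv:2405.10495:
  eigenvalue (almost-)rigidity of `Δ_f` only at the Gaussian end. Donovan 2503.15033 remains the only 2024–25 item on `S⁴` itself.
* (v10) LITERATURE to 2026-08-16 (arXiv backend live; searchd/OpenAlex/S2 degraded this session): new since v9 and checked —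
  Wu–Wu arXiv:2505.02315 (non-compact 4-d shrinkers with `Ric ≥ 0`: `K ≤ 1/4` or `R ≤ 3` + asymptotics ⇒ cylinder rigidity; nothing
  compact), Chan–Zhang 2605.08884 (LOCAL `ν`-gap near the Gaussian end), Fei He 2605.04476 / 2607.21959 (Betti-number bounds via weighted
  `L²`-cohomology and `Δ_f`-spectral counting — qualitative, no density threshold), Wang–Wu 2604.23939 (constant `R`), Naff–Ozuch 2509.05470
  (linear stability of FIK), Lauret–Tolcachier 2506.12435 (`ν`-linear stability of homogeneous Einstein spaces), Bhattacharya–Prakash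
  2606.13066 (solitons as critical points of quadratic functionals). Still NO theorem linking `sup R`, `D` or `∫|W|²` of a compact shrinker
  to its density, no entropy gap at the cylinder, no new compact 4-d shrinker, nothing on `S⁴` beyond Donovan 2025; `ledger negatives`: 0.
* (v8) WHAT A PROOF OF STUB 1 MUST USE (negative knowledge, kernel-checked §14): not the scalar toolkit, not the
  weighted identities in `f`, not `0 < R ≤ f` with `∫R = 2V` — these admit violators with `D/V → ∞`. The live inputs
  are (a) a sup bound `R_max = f_max ≤ 3.08` on dense homotopy-sphere shrinkers (no printed theorem links `sup R` to
  `Θ`; false generically among sparse orbifold shrinkers, §11), or (b) tensorial/PDE structure: e.g. regions with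
  `Ric ≪ ½g` force `Hess f ≈ ½g` (strict convexity of `f`, no short closed geodesics — Gaussian-soliton geometry), and
  §15 says `> 94 %` of the volume of a violator at `V ≈ 95π²` sits in `{f < 3}` with `R` far from `2` on average: a
  quantitative "three Gaussian shells' worth of almost-flat volume at `f ≈ 2`" picture (the Gaussian soliton itself has
  only `Vol{1.5 ≤ f ≤ 2.5} = 32π²`), which no known compact or non-compact shrinker exhibits.
-/

noncomputable section

namespace Summit.SmoothPoincare4.SmoothPoincare4.Cruxes.CompactShrinkerGap.Disproof

set_option linter.dupNamespace false

open scoped Manifold ContDiff ENNReal Topology RealInnerProductSpace ContinuousMap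
open MeasureTheory Set
open Summit.SmoothPoincare4.SmoothPoincare4.Theses.EntropyRung
open Literature.Geometry.Riemannian Literature.Geometry.Lorentzian
open Literature.Geometry.Lorentzian.PseudoRiemannianMetric

/-! ## §0 The SPC4 sandwich: any refutation is an exotic 4-sphere -/

/-- **`SPC4 ⇒ CompactShrinkerGap`**: the crux's conclusion `Nonempty (M ≃ₘ S⁴)` is the summit's
conclusion for the same `M`, and all the analytic hypotheses are simply discarded. Hence
`¬ CompactShrinkerGap` exhibits an exotic smooth homotopy 4-sphere: the crux cannot be refuted
short of refuting the summit. [folklore] -/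
theorem spc4_implies : _root_.SmoothPoincare4 → CompactShrinkerGap := by
  intro h M _ _ _ _ _ _ _ _ _ e g _ f hg _ _ _ _
  exact h M ‹_› ‹_› e

/-- Contrapositive packaging of `spc4_implies`: a disproof of the crux disproves SPC4. [folklore] -/
theorem not_compactShrinkerGap_imp_not_spc4 : ¬ CompactShrinkerGap → ¬ _root_.SmoothPoincare4 :=
  mt spc4_implies

/-! ## §1 Non-vacuity and tightness at the round shrinker `S⁴(√6)` -/

/-- The four analytic hypotheses of the crux, bundled (verbatim sub-terms of the route decl). [folklore] -/
def Hyps (M : Type) [TopologicalSpace M] [ChartedSpace (EuclideanSpace ℝ (Fin 4)) M]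
    [IsManifold (𝓡 4) ∞ M] [T3Space M] [MeasurableSpace M] [BorelSpace M]
    (g : PseudoRiemannianMetric (𝓡 4) ∞ (EuclideanSpace ℝ (Fin 4)) (TangentSpace (𝓡 4) : M → Type _))
    [g.HasLeviCivita] (f : M → ℝ) (hg : g.IsRiemannian) : Prop :=
  ContMDiff (𝓡 4) 𝓘(ℝ, ℝ) ∞ f ∧
  (∀ (x : M) (X Y : TangentSpace (𝓡 4) x), g.ricci x X Y + g.hessian f x X Y = (1 / 2 : ℝ) * g.val x X Y) ∧
  (∀ x : M, g.scalarCurvature x + g.gradSq f x = f x) ∧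
  ENNReal.ofReal (32 * Real.pi ^ 2 * Real.sqrt Real.pi * Real.exp (-(3 : ℝ) / 2)) <
    ∫⁻ x, ENNReal.ofReal (Real.exp (-f x)) ∂(riemannianMeasure (g.toContMDiffRiemannianMetric hg))

/-- The crux restated through `Hyps` (definitional). [folklore] -/
theorem compactShrinkerGap_iff_hyps :
    CompactShrinkerGap ↔
    ∀ (M : Type) [TopologicalSpace M] [T2Space M] [SecondCountableTopology M]
      [ChartedSpace (EuclideanSpace ℝ (Fin 4)) M] [IsManifold (𝓡 4) ∞ M] [CompactSpace M] [T3Space M]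
      [MeasurableSpace M] [BorelSpace M], M ≃ₕ Metric.sphere (0 : EuclideanSpace ℝ (Fin 5)) 1 →
      ∀ (g : PseudoRiemannianMetric (𝓡 4) ∞ (EuclideanSpace ℝ (Fin 4)) (TangentSpace (𝓡 4) : M → Type _))
        [g.HasLeviCivita] (f : M → ℝ) (hg : g.IsRiemannian), Hyps M g f hg →
        Nonempty (M ≃ₘ⟮𝓡 4, 𝓡 4⟯ (Metric.sphere (0 : EuclideanSpace ℝ (Fin 5)) 1)) := by
  constructor
  · intro h M _ _ _ _ _ _ _ _ _ e g _ f hg H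
    exact h M e g f hg H.1 H.2.1 H.2.2.1 H.2.2.2
  · intro h M _ _ _ _ _ _ _ _ _ e g _ f hg h1 h2 h3 h4
    exact h M e g f hg ⟨h1, h2, h3, h4⟩

/-- **NON-VACUITY**: the round shrinker `(S⁴, 6 g_rd, f ≡ 2)` satisfies every typed hypothesis of
the crux — `Ric(6g_rd) = ½(6g_rd)`, `Hess 2 = 0`, `R = 2`, `|∇2|² = 0`, and
`∫ e^{-2} dV = 96π²e^{-2} ≈ 128.2 > 32π²√π e^{-3/2} ≈ 124.9` (Cao–Hamilton–Ilmanen 2004 §4: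
`Θ(S⁴) = .812 > Θ(S³×ℝ) = .791`). So the crux is not provable "for lack of instances", and the
typed sign/scale conventions (`½`, `τ = 1`) are the ones under which the round sphere passes.
[cite: CaoHamiltonIlmanen2004, §4] -/
theorem hyps_round :
    Hyps SphereFour shrinkingSphereFourMetric (fun _ ↦ 2) isRiemannian_shrinkingSphereFourMetric := by
  refine ⟨contMDiff_const, ?_, ?_, ?_⟩
  · intro x X Y
    rw [ricci_shrinkingSphereFourMetric, hessian_constFun]
    simp
  · intro x
    rw [scalarCurvature_shrinkingSphereFourMetric, gradSq_const]
    norm_num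
  · have h := lintegral_exp_neg_two_shrinkingSphereFour
    simp only at h ⊢
    rw [h]
    exact (ENNReal.ofReal_lt_ofReal_iff (by positivity)).mpr cylinderDensityBound_lt_shrinkingSphereFour

/-- The conclusion of the crux at `M = S⁴` holds by the identity diffeomorphism (so the instance
`M := S⁴` of the crux is true whatever `(g, f)` is). [folklore] -/
theorem conclusion_round : Nonempty (SphereFour ≃ₘ⟮𝓡 4, 𝓡 4⟯ SphereFour) := ⟨Diffeomorph.refl _ _ _⟩

/-- **Density ratio** `∫_{S⁴(√6)} e^{-2} dV / (32π²√π e^{-3/2}) = 3 / (√π · e^{1/2})`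
(`= Θ(S⁴)/Θ(S³×ℝ)`). [cite: CaoHamiltonIlmanen2004, §4] -/
theorem density_ratio_eq :
    Real.exp (-2) * (6 ^ 2 * (8 * Real.pi ^ 2 / 3)) / (32 * Real.pi ^ 2 * Real.sqrt Real.pi * Real.exp (-(3 : ℝ) / 2))
      = 3 / (Real.sqrt Real.pi * Real.exp (1 / 2)) := by
  have hπ := Real.pi_pos
  have hs : 0 < Real.sqrt Real.pi := Real.sqrt_pos.mpr hπ
  have h2 : Real.exp (-(3 : ℝ) / 2) = Real.exp (-2) * Real.exp (1 / 2) := by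
    rw [← Real.exp_add]; norm_num
  rw [h2]
  field_simp
  ring

/-- **TIGHTNESS at the round sphere**: `1.026 < Θ(S⁴)/Θ(S³×ℝ) < 1.027` — the model case clears
the crux's bar by less than `2.7 %` (and more than `2.6 %`). Any quantitative proof strategy must
be sharp to within this window; any perturbative counterexample search starts `2.6 %` above the
bar. [cite: CaoHamiltonIlmanen2004, §4] -/
theorem density_ratio_window :
    1.026 < 3 / (Real.sqrt Real.pi * Real.exp (1 / 2)) ∧ 3 / (Real.sqrt Real.pi * Real.exp (1 / 2)) < 1.027 := by
  have hπ := Real.pi_pos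
  have hs : 0 < Real.sqrt Real.pi := Real.sqrt_pos.mpr hπ
  have he : 0 < Real.exp (1 / 2) := Real.exp_pos _
  have hprod : 0 < Real.sqrt Real.pi * Real.exp (1 / 2) := mul_pos hs he
  -- squares: (√π e^{1/2})² = π e, and 8.5206 < π e < 8.5497
  have hsq : (Real.sqrt Real.pi * Real.exp (1 / 2)) ^ 2 = Real.pi * Real.exp 1 := by
    rw [mul_pow, Real.sq_sqrt hπ.le, ← Real.exp_nat_mul]; norm_num
  have hpi_lo : 3.141592 < Real.pi := Real.pi_gt_d6
  have hpi_hi : Real.pi < 3.141593 := Real.pi_lt_d6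
  have he_lo : 2.7182818283 < Real.exp 1 := Real.exp_one_gt_d9
  have he_hi : Real.exp 1 < 2.7182818286 := Real.exp_one_lt_d9
  have hlo : (3 / 1.027 : ℝ) ^ 2 < (Real.sqrt Real.pi * Real.exp (1 / 2)) ^ 2 := by
    rw [hsq]; nlinarith
  have hhi : (Real.sqrt Real.pi * Real.exp (1 / 2)) ^ 2 < (3 / 1.026 : ℝ) ^ 2 := by
    rw [hsq]; nlinarith
  have hlo' : 3 / 1.027 < Real.sqrt Real.pi * Real.exp (1 / 2) :=
    lt_of_pow_lt_pow_left₀ 2 hprod.le hlo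
  have hhi' : Real.sqrt Real.pi * Real.exp (1 / 2) < 3 / 1.026 :=
    lt_of_pow_lt_pow_left₀ 2 (by norm_num) hhi
  constructor
  · rw [lt_div_iff₀ hprod]
    calc 1.026 * (Real.sqrt Real.pi * Real.exp (1 / 2)) < 1.026 * (3 / 1.026) := by
          exact mul_lt_mul_of_pos_left hhi' (by norm_num)
      _ = 3 := by norm_num
  · rw [div_lt_iff₀ hprod]
    calc (3 : ℝ) = 1.027 * (3 / 1.027) := by norm_num
      _ < 1.027 * (Real.sqrt Real.pi * Real.exp (1 / 2)) := mul_lt_mul_of_pos_left hlo' (by norm_num)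

/-! ## §2 The `[CompactSpace M]` binder is redundant -/

/-- The crux with the `[CompactSpace M]` binder deleted (everything else verbatim; the measure
`riemannianMeasure` only needs `T3Space`). [folklore] -/
def NoCompactBinder : Prop :=
  ∀ (M : Type) [TopologicalSpace M] [T2Space M] [SecondCountableTopology M]
    [ChartedSpace (EuclideanSpace ℝ (Fin 4)) M] [IsManifold (𝓡 4) ∞ M] [T3Space M]
    [MeasurableSpace M] [BorelSpace M], M ≃ₕ Metric.sphere (0 : EuclideanSpace ℝ (Fin 5)) 1 →
    ∀ (g : PseudoRiemannianMetric (𝓡 4) ∞ (EuclideanSpace ℝ (Fin 4)) (TangentSpace (𝓡 4) : M → Type _))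
      [g.HasLeviCivita] (f : M → ℝ) (hg : g.IsRiemannian), Hyps M g f hg →
      Nonempty (M ≃ₘ⟮𝓡 4, 𝓡 4⟯ (Metric.sphere (0 : EuclideanSpace ℝ (Fin 5)) 1))

/-- **`[CompactSpace M]` is load-free**: it follows from `M ≃ₕ S⁴` (Hatcher Prop. 3.29, proved in
the tree as `compactSpace_of_homotopyEquiv_sphere_four_holds`), so deleting the binder does not
change the proposition. (Information for provers: closedness IS used by every intended proof, but
it is available from `e`, not an extra assumption.) [cite: HatcherAT2002, Prop. 3.29] -/
theorem compactShrinkerGap_iff_noCompactBinder : CompactShrinkerGap ↔ NoCompactBinder := by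
  rw [compactShrinkerGap_iff_hyps]
  constructor
  · intro h M _ _ _ _ _ _ _ _ e g _ f hg H
    haveI : CompactSpace M :=
      Literature.Topology.FourManifolds.compactSpace_of_homotopyEquiv_sphere_four_holds M e
    exact h M e g f hg H
  · intro h M _ _ _ _ _ _ _ _ _ e g _ f hg H
    exact h M e g f hg H

/-! ## §3 Dropping `M ≃ₕ S⁴` and compactness: FALSE (Gaussian shrinker); sharp (cylinder) -/

/-- The crux with BOTH `[CompactSpace M]` and the homotopy equivalence `M ≃ₕ S⁴` deleted. [folklore] -/
def WithoutCompactHomotopy : Prop :=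
  ∀ (M : Type) [TopologicalSpace M] [T2Space M] [SecondCountableTopology M]
    [ChartedSpace (EuclideanSpace ℝ (Fin 4)) M] [IsManifold (𝓡 4) ∞ M] [T3Space M]
    [MeasurableSpace M] [BorelSpace M],
    ∀ (g : PseudoRiemannianMetric (𝓡 4) ∞ (EuclideanSpace ℝ (Fin 4)) (TangentSpace (𝓡 4) : M → Type _))
      [g.HasLeviCivita] (f : M → ℝ) (hg : g.IsRiemannian), Hyps M g f hg →
      Nonempty (M ≃ₘ⟮𝓡 4, 𝓡 4⟯ (Metric.sphere (0 : EuclideanSpace ℝ (Fin 5)) 1))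

/-- The Gaussian shrinker `(ℝ⁴, δ, |x|²/4)` satisfies the four analytic hypotheses:
`Ric = 0`, `Hess f = δ/2`, `R = 0`, `|∇f|² = f`, `∫ e^{-f} dx = 16π² > 32π²√π e^{-3/2}`
(`Θ(ℝ⁴) = 1 > .791`; all clauses from `Literature/Geometry/Riemannian/GaussianShrinker.lean`).
[cite: CaoHamiltonIlmanen2004, §4] -/
theorem hyps_gaussian :
    Hyps EuclideanFour (euclideanMetric EuclideanFour) gaussianPotential isRiemannian_euclideanMetric := by
  refine ⟨contDiff_gaussianPotential.contMDiff, ?_, ?_, ?_⟩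
  · intro x X Y
    rw [ricci_euclideanMetric, hessian_gaussianPotential, euclideanMetric_apply]
    simp only [LinearMap.zero_apply, zero_add]
    rw [div_eq_inv_mul, one_div]
    rfl
  · intro x
    rw [scalarCurvature_euclideanMetric, gradSq_gaussianPotential, zero_add]
  · change ENNReal.ofReal _ < ∫⁻ x, ENNReal.ofReal (Real.exp (-gaussianPotential x)) ∂(riemannianMeasure euclideanFourMetric)
    rw [riemannianMeasure_euclideanFour, lintegral_exp_neg_gaussianPotential]
    exact (ENNReal.ofReal_lt_ofReal_iff (by positivity)).mpr cylinderDensityBound_lt_gaussian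

/-- `ℝ⁴` is not diffeomorphic (indeed not homeomorphic) to `S⁴`: one is non-compact, the other
compact. [folklore] -/
theorem isEmpty_diffeomorph_euclideanFour_sphere :
    IsEmpty (EuclideanFour ≃ₘ⟮𝓡 4, 𝓡 4⟯ (Metric.sphere (0 : EuclideanSpace ℝ (Fin 5)) 1)) := by
  refine ⟨fun Φ ↦ ?_⟩
  haveI : CompactSpace EuclideanFour := Φ.toHomeomorph.symm.compactSpace
  exact not_compactSpace_iff.mpr (inferInstance : NoncompactSpace EuclideanFour) this

/-- **LOAD-BEARING (closedness via `M ≃ₕ S⁴`)**: with compactness and the homotopy equivalence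
both dropped the crux is FALSE — witness the Gaussian shrinker on `ℝ⁴` (`Θ = 1 > .791`, `ℝ⁴ ≇ S⁴`).
Any proof must use that `M` is closed (which it gets from `e`). PAPER complement: the witness is
flat; the NON-FLAT non-compact model `S³(2)×ℝ` sits exactly AT the bar
(`cylinder_weightedVolume`), so no lowering of the constant rescues this variant either — this is
the content of the sibling crux `NoncompactShrinkerGap`. [cite: CaoHamiltonIlmanen2004, §4] -/
theorem withoutCompactHomotopy_false : ¬ WithoutCompactHomotopy := by
  intro h
  have hne := h EuclideanFour (euclideanMetric EuclideanFour) gaussianPotential isRiemannian_euclideanMetric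
    hyps_gaussian
  exact isEmpty_diffeomorph_euclideanFour_sphere.false hne.some

/-- **Where the constant comes from** (PAPER model, arithmetic checked): on the cylinder
`S³(2) × ℝ` with `f = z²/4 + 3/2` one has `Vol(S³(2)) = 2π²·2³ = 16π²`,
`∫_ℝ e^{-z²/4} dz = 2√π`, so `∫ e^{-f} dV = 16π² · 2√π · e^{-3/2} = 32π²√π e^{-3/2}` — the crux's
threshold is the cylinder's weighted volume, attained. [cite: CaoHamiltonIlmanen2004, §4] -/
theorem cylinder_weightedVolume :
    (2 * Real.pi ^ 2 * 2 ^ 3) * (∫ z : ℝ, Real.exp (-(z ^ 2 / 4 + 3 / 2))) =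
      32 * Real.pi ^ 2 * Real.sqrt Real.pi * Real.exp (-(3 : ℝ) / 2) := by
  have hfun : (fun z : ℝ ↦ Real.exp (-(z ^ 2 / 4 + 3 / 2))) =
      fun z ↦ Real.exp (-(3 : ℝ) / 2) * Real.exp (-(1 / 4 : ℝ) * z ^ 2) := by
    funext z; rw [← Real.exp_add]; ring_nf
  rw [hfun, integral_const_mul, integral_gaussian]
  have h4 : Real.sqrt (Real.pi / (1 / 4 : ℝ)) = 2 * Real.sqrt Real.pi := by
    rw [show Real.pi / (1 / 4 : ℝ) = 2 ^ 2 * Real.pi by ring, Real.sqrt_mul (by norm_num),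
      Real.sqrt_sq (by norm_num)]
  rw [h4]; ring

/-! ## §4 Dropping only `M ≃ₕ S⁴` (compactness kept): open when connected; disconnected witness -/

/-- The crux with the homotopy equivalence deleted but `[CompactSpace M]` kept: "every closed
4-manifold carrying a normalised shrinker of density `> Θ(S³×ℝ)` is diffeomorphic to `S⁴`". [folklore] -/
def WithoutHomotopy : Prop :=
  ∀ (M : Type) [TopologicalSpace M] [T2Space M] [SecondCountableTopology M]
    [ChartedSpace (EuclideanSpace ℝ (Fin 4)) M] [IsManifold (𝓡 4) ∞ M] [CompactSpace M] [T3Space M]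
    [MeasurableSpace M] [BorelSpace M],
    ∀ (g : PseudoRiemannianMetric (𝓡 4) ∞ (EuclideanSpace ℝ (Fin 4)) (TangentSpace (𝓡 4) : M → Type _))
      [g.HasLeviCivita] (f : M → ℝ) (hg : g.IsRiemannian), Hyps M g f hg →
      Nonempty (M ≃ₘ⟮𝓡 4, 𝓡 4⟯ (Metric.sphere (0 : EuclideanSpace ℝ (Fin 5)) 1))

/-- `WithoutHomotopy` trivially implies the crux (it has fewer hypotheses). STATUS of the
converse direction / of `WithoutHomotopy` itself: for CONNECTED `M` it is the (open) expectation
read off the Cao–Hamilton–Ilmanen table that `S⁴` (`.812`) is the densest compact non-flat 4-d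
shrinker — densest known competitors `ℂP²` `.609`, `S²×S²` `.541`, Koiso–Cao `.518`, Page `.517`,
`ℝP⁴` `.406`; no theorem excludes a compact shrinker with `Θ ∈ (.791, .812)` on `M ≇ S⁴`.
For DISCONNECTED `M` it is false on paper: `S⁴(√6) ⊔ S⁴(√6)` with `f ≡ 2` on both copies has
`∫ e^{-f} = 2·96π²e^{-2} > thr` (`two_round_gt_threshold`) and is not even homeomorphic to `S⁴`
(`sum_sphereFour_not_homeomorphic`); only the packaging of `g ⊕ g` as one
`PseudoRiemannianMetric` on the `Sum` manifold is missing from the tree. [cite: CaoHamiltonIlmanen2004, §4] -/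
theorem withoutHomotopy_implies : WithoutHomotopy → CompactShrinkerGap := by
  rw [compactShrinkerGap_iff_hyps]
  intro h M _ _ _ _ _ _ _ _ _ _ g _ f hg H
  exact h M g f hg H

/-- Arithmetic of the disconnected witness: two round shrinkers have total weighted volume
`2 · 96π² e^{-2} ≈ 256.5 > 124.9`. [folklore] -/
theorem two_round_gt_threshold :
    32 * Real.pi ^ 2 * Real.sqrt Real.pi * Real.exp (-(3 : ℝ) / 2) <
      2 * (Real.exp (-2) * (6 ^ 2 * (8 * Real.pi ^ 2 / 3))) := by
  have h := cylinderDensityBound_lt_shrinkingSphereFour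
  have hpos : 0 < Real.exp (-2) * (6 ^ 2 * (8 * Real.pi ^ 2 / 3)) := by positivity
  linarith

/-- Topology of the disconnected witness: `S⁴ ⊔ S⁴` is not homeomorphic to `S⁴` (the latter is
connected, the former is not: `range inl` is a proper non-empty clopen). [folklore] -/
theorem sum_sphereFour_not_homeomorphic : IsEmpty ((SphereFour ⊕ SphereFour) ≃ₜ SphereFour) := by
  refine ⟨fun φ ↦ ?_⟩
  haveI : ConnectedSpace (SphereFour ⊕ SphereFour) := φ.symm.surjective.connectedSpace φ.symm.continuous
  have hclopen : IsClopen (Set.range (Sum.inl : SphereFour → SphereFour ⊕ SphereFour)) := isClopen_range_inl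
  obtain ⟨p⟩ : Nonempty SphereFour := inferInstance
  rcases isClopen_iff.mp hclopen with h | h
  · exact (Set.eq_empty_iff_forall_notMem.mp h) (Sum.inl p) ⟨p, rfl⟩
  · have : (Sum.inr p : SphereFour ⊕ SphereFour) ∈ Set.range (Sum.inl : SphereFour → SphereFour ⊕ SphereFour) := by
      rw [h]; trivial
    obtain ⟨q, hq⟩ := this
    exact Sum.inl_ne_inr hq

/-! ## §5 Dropping an analytic hypothesis: still SPC4-implied (no cheap kill exists) -/

/-- Crux minus the DENSITY floor: "a homotopy 4-sphere carrying any normalised shrinker is standard". [folklore] -/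
def WithoutDensity : Prop :=
  ∀ (M : Type) [TopologicalSpace M] [T2Space M] [SecondCountableTopology M]
    [ChartedSpace (EuclideanSpace ℝ (Fin 4)) M] [IsManifold (𝓡 4) ∞ M] [CompactSpace M] [T3Space M]
    [MeasurableSpace M] [BorelSpace M], M ≃ₕ Metric.sphere (0 : EuclideanSpace ℝ (Fin 5)) 1 →
    ∀ (g : PseudoRiemannianMetric (𝓡 4) ∞ (EuclideanSpace ℝ (Fin 4)) (TangentSpace (𝓡 4) : M → Type _))
      [g.HasLeviCivita] (f : M → ℝ) (_hg : g.IsRiemannian), ContMDiff (𝓡 4) 𝓘(ℝ, ℝ) ∞ f →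
      (∀ (x : M) (X Y : TangentSpace (𝓡 4) x), g.ricci x X Y + g.hessian f x X Y = (1 / 2 : ℝ) * g.val x X Y) →
      (∀ x : M, g.scalarCurvature x + g.gradSq f x = f x) →
      Nonempty (M ≃ₘ⟮𝓡 4, 𝓡 4⟯ (Metric.sphere (0 : EuclideanSpace ℝ (Fin 5)) 1))

/-- Crux minus the SOLITON equation (normalisation and density kept). PAPER: equivalent to SPC4 —
on any closed `Σ` take a constant-scalar-curvature metric (Yamabe) scaled so that `R ≡ c` is tiny
and `f ≡ c`: then `R + |∇f|² = f` and `∫ e^{-c} dV → ∞`. [folklore] -/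
def WithoutSoliton : Prop :=
  ∀ (M : Type) [TopologicalSpace M] [T2Space M] [SecondCountableTopology M]
    [ChartedSpace (EuclideanSpace ℝ (Fin 4)) M] [IsManifold (𝓡 4) ∞ M] [CompactSpace M] [T3Space M]
    [MeasurableSpace M] [BorelSpace M], M ≃ₕ Metric.sphere (0 : EuclideanSpace ℝ (Fin 5)) 1 →
    ∀ (g : PseudoRiemannianMetric (𝓡 4) ∞ (EuclideanSpace ℝ (Fin 4)) (TangentSpace (𝓡 4) : M → Type _))
      [g.HasLeviCivita] (f : M → ℝ) (hg : g.IsRiemannian), ContMDiff (𝓡 4) 𝓘(ℝ, ℝ) ∞ f →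
      (∀ x : M, g.scalarCurvature x + g.gradSq f x = f x) →
      ENNReal.ofReal (32 * Real.pi ^ 2 * Real.sqrt Real.pi * Real.exp (-(3 : ℝ) / 2)) <
        ∫⁻ x, ENNReal.ofReal (Real.exp (-f x)) ∂(riemannianMeasure (g.toContMDiffRiemannianMetric hg)) →
      Nonempty (M ≃ₘ⟮𝓡 4, 𝓡 4⟯ (Metric.sphere (0 : EuclideanSpace ℝ (Fin 5)) 1))

/-- Crux minus the NORMALISATION `R + |∇f|² = f` (soliton equation and density kept). PAPER: the
normalisation only pins the additive constant of `f` (on a connected shrinker `R + |∇f|² - f` is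
constant), so dropping it lets `f ↦ f - c` inflate `∫ e^{-f}` at will: equivalent to "a homotopy
4-sphere carrying any shrinker is standard", again SPC4-implied and open. [folklore] -/
def WithoutNormalisation : Prop :=
  ∀ (M : Type) [TopologicalSpace M] [T2Space M] [SecondCountableTopology M]
    [ChartedSpace (EuclideanSpace ℝ (Fin 4)) M] [IsManifold (𝓡 4) ∞ M] [CompactSpace M] [T3Space M]
    [MeasurableSpace M] [BorelSpace M], M ≃ₕ Metric.sphere (0 : EuclideanSpace ℝ (Fin 5)) 1 →
    ∀ (g : PseudoRiemannianMetric (𝓡 4) ∞ (EuclideanSpace ℝ (Fin 4)) (TangentSpace (𝓡 4) : M → Type _))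
      [g.HasLeviCivita] (f : M → ℝ) (hg : g.IsRiemannian), ContMDiff (𝓡 4) 𝓘(ℝ, ℝ) ∞ f →
      (∀ (x : M) (X Y : TangentSpace (𝓡 4) x), g.ricci x X Y + g.hessian f x X Y = (1 / 2 : ℝ) * g.val x X Y) →
      ENNReal.ofReal (32 * Real.pi ^ 2 * Real.sqrt Real.pi * Real.exp (-(3 : ℝ) / 2)) <
        ∫⁻ x, ENNReal.ofReal (Real.exp (-f x)) ∂(riemannianMeasure (g.toContMDiffRiemannianMetric hg)) →
      Nonempty (M ≃ₘ⟮𝓡 4, 𝓡 4⟯ (Metric.sphere (0 : EuclideanSpace ℝ (Fin 5)) 1))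

/-- Crux minus SMOOTHNESS of `f` (with junk `hessian`/`gradSq` values off the smooth locus). [folklore] -/
def WithoutSmooth : Prop :=
  ∀ (M : Type) [TopologicalSpace M] [T2Space M] [SecondCountableTopology M]
    [ChartedSpace (EuclideanSpace ℝ (Fin 4)) M] [IsManifold (𝓡 4) ∞ M] [CompactSpace M] [T3Space M]
    [MeasurableSpace M] [BorelSpace M], M ≃ₕ Metric.sphere (0 : EuclideanSpace ℝ (Fin 5)) 1 →
    ∀ (g : PseudoRiemannianMetric (𝓡 4) ∞ (EuclideanSpace ℝ (Fin 4)) (TangentSpace (𝓡 4) : M → Type _))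
      [g.HasLeviCivita] (f : M → ℝ) (hg : g.IsRiemannian),
      (∀ (x : M) (X Y : TangentSpace (𝓡 4) x), g.ricci x X Y + g.hessian f x X Y = (1 / 2 : ℝ) * g.val x X Y) →
      (∀ x : M, g.scalarCurvature x + g.gradSq f x = f x) →
      ENNReal.ofReal (32 * Real.pi ^ 2 * Real.sqrt Real.pi * Real.exp (-(3 : ℝ) / 2)) <
        ∫⁻ x, ENNReal.ofReal (Real.exp (-f x)) ∂(riemannianMeasure (g.toContMDiffRiemannianMetric hg)) →
      Nonempty (M ≃ₘ⟮𝓡 4, 𝓡 4⟯ (Metric.sphere (0 : EuclideanSpace ℝ (Fin 5)) 1))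

/-- Each single-hypothesis drop is still a corollary of SPC4, hence — exactly like the crux — not
refutable short of an exotic sphere. So no `_false_without_` theorem can exist for the analytic
hypotheses; their role is to make the crux EASIER than SPC4, not to make it true. [folklore] -/
theorem spc4_implies_withoutDensity : _root_.SmoothPoincare4 → WithoutDensity := by
  intro h M _ _ _ _ _ _ _ _ _ e g _ f _ _ _ _
  exact h M ‹_› ‹_› e

/-- See `spc4_implies_withoutDensity`. [folklore] -/
theorem spc4_implies_withoutSoliton : _root_.SmoothPoincare4 → WithoutSoliton := by
  intro h M _ _ _ _ _ _ _ _ _ e g _ f _ _ _ _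
  exact h M ‹_› ‹_› e

/-- See `spc4_implies_withoutDensity`. [folklore] -/
theorem spc4_implies_withoutNormalisation : _root_.SmoothPoincare4 → WithoutNormalisation := by
  intro h M _ _ _ _ _ _ _ _ _ e g _ f _ _ _ _
  exact h M ‹_› ‹_› e

/-- See `spc4_implies_withoutDensity`. [folklore] -/
theorem spc4_implies_withoutSmooth : _root_.SmoothPoincare4 → WithoutSmooth := by
  intro h M _ _ _ _ _ _ _ _ _ e g _ f _ _ _ _
  exact h M ‹_› ‹_› e

/-- And each drop implies the crux back (fewer hypotheses). [folklore] -/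
theorem withoutDensity_implies : WithoutDensity → CompactShrinkerGap := by
  intro h M _ _ _ _ _ _ _ _ _ e g _ f hg h1 h2 h3 _
  exact h M e g f hg h1 h2 h3

/-- See `withoutDensity_implies`. [folklore] -/
theorem withoutSoliton_implies : WithoutSoliton → CompactShrinkerGap := by
  intro h M _ _ _ _ _ _ _ _ _ e g _ f hg h1 _ h3 h4
  exact h M e g f hg h1 h3 h4

/-- See `withoutDensity_implies`. [folklore] -/
theorem withoutNormalisation_implies : WithoutNormalisation → CompactShrinkerGap := by
  intro h M _ _ _ _ _ _ _ _ _ e g _ f hg h1 h2 _ h4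
  exact h M e g f hg h1 h2 h4

/-- See `withoutDensity_implies`. [folklore] -/
theorem withoutSmooth_implies : WithoutSmooth → CompactShrinkerGap := by
  intro h M _ _ _ _ _ _ _ _ _ e g _ f hg _ h2 h3 h4
  exact h M e g f hg h2 h3 h4

/-! ## §6 Jensen volume floor: a counterexample is volume-near-round -/

/-- Pointwise tangent-line inequality behind the volume floor: `(t - 1) e^{-t} ≤ e^{-2}`
(equality at `t = 2`; from `1 + x ≤ eˣ` at `x = t - 2`). [folklore] -/
theorem sub_one_mul_exp_neg_le (t : ℝ) : (t - 1) * Real.exp (-t) ≤ Real.exp (-2) := by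
  have h1 : t - 2 + 1 ≤ Real.exp (t - 2) := Real.add_one_le_exp (t - 2)
  have h2 : 0 < Real.exp (-t) := Real.exp_pos _
  calc (t - 1) * Real.exp (-t) ≤ Real.exp (t - 2) * Real.exp (-t) := by
        apply mul_le_mul_of_nonneg_right _ h2.le; linarith
    _ = Real.exp (-2) := by rw [← Real.exp_add]; ring_nf

/-- **Jensen volume floor (measure-theoretic core)**: on a finite measure space, if
`∫ f e^{-f} = 2 ∫ e^{-f}` (the integrated shrinker identity `∫ (Δ_f f) e^{-f} dV = 0` with
`Δ_f f = 2 - f` on a closed normalised 4-d shrinker — PROVER INPUT, not assumed about the crux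
here) then `∫ e^{-f} dμ ≤ e^{-2} μ(univ)`, with equality iff `f ≡ 2` a.e. (Einstein case).
[cite: CaoHamiltonIlmanen2004, §4] -/
theorem integral_exp_neg_le_of_mean_two {α : Type*} [MeasurableSpace α] (μ : Measure α)
    [IsFiniteMeasure μ] (f : α → ℝ)
    (h₁ : Integrable (fun x ↦ Real.exp (-f x)) μ)
    (h₂ : Integrable (fun x ↦ f x * Real.exp (-f x)) μ)
    (hid : ∫ x, f x * Real.exp (-f x) ∂μ = 2 * ∫ x, Real.exp (-f x) ∂μ) :
    ∫ x, Real.exp (-f x) ∂μ ≤ Real.exp (-2) * (μ univ).toReal := by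
  have hkey : ∫ x, Real.exp (-f x) ∂μ = ∫ x, (f x - 1) * Real.exp (-f x) ∂μ := by
    have : (fun x ↦ (f x - 1) * Real.exp (-f x)) = fun x ↦ f x * Real.exp (-f x) - Real.exp (-f x) := by
      funext x; ring
    rw [this, integral_sub h₂ h₁, hid]; ring
  rw [hkey]
  calc ∫ x, (f x - 1) * Real.exp (-f x) ∂μ ≤ ∫ _, Real.exp (-2) ∂μ := by
        apply integral_mono (h₂.sub h₁ |>.congr _) (integrable_const _)
        · intro x; exact sub_one_mul_exp_neg_le (f x)
        · exact ae_of_all _ fun x ↦ by simp only [Pi.sub_apply]; ring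
    _ = Real.exp (-2) * (μ univ).toReal := by
        rw [integral_const, smul_eq_mul, Measure.real]; ring

/-- **Volume floor for a counterexample**: under the same identity, the crux's density hypothesis
(in its `lintegral` form) forces `μ(univ) > 32π²√π e^{1/2} ≈ 922.9`. [cite: CaoHamiltonIlmanen2004, §4] -/
theorem volume_floor_of_density {α : Type*} [MeasurableSpace α] (μ : Measure α)
    [IsFiniteMeasure μ] (f : α → ℝ)
    (h₁ : Integrable (fun x ↦ Real.exp (-f x)) μ)
    (h₂ : Integrable (fun x ↦ f x * Real.exp (-f x)) μ)
    (hid : ∫ x, f x * Real.exp (-f x) ∂μ = 2 * ∫ x, Real.exp (-f x) ∂μ)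
    (hdens : ENNReal.ofReal (32 * Real.pi ^ 2 * Real.sqrt Real.pi * Real.exp (-(3 : ℝ) / 2)) <
      ∫⁻ x, ENNReal.ofReal (Real.exp (-f x)) ∂μ) :
    32 * Real.pi ^ 2 * Real.sqrt Real.pi * Real.exp (1 / 2) < (μ univ).toReal := by
  have hJ := integral_exp_neg_le_of_mean_two μ f h₁ h₂ hid
  rw [← ofReal_integral_eq_lintegral_ofReal h₁ (ae_of_all _ fun x ↦ (Real.exp_pos _).le),
    ENNReal.ofReal_lt_ofReal_iff'] at hdens
  have h3 : 32 * Real.pi ^ 2 * Real.sqrt Real.pi * Real.exp (-(3 : ℝ) / 2) < Real.exp (-2) * (μ univ).toReal :=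
    hdens.1.trans_le hJ
  have h4 : Real.exp (1 / 2) = Real.exp (-(3 : ℝ) / 2) * Real.exp 2 := by
    rw [← Real.exp_add]; norm_num
  have h5 : Real.exp (-2) * Real.exp 2 = 1 := by rw [← Real.exp_add]; norm_num
  calc 32 * Real.pi ^ 2 * Real.sqrt Real.pi * Real.exp (1 / 2)
      = (32 * Real.pi ^ 2 * Real.sqrt Real.pi * Real.exp (-(3 : ℝ) / 2)) * Real.exp 2 := by rw [h4]; ring
    _ < (Real.exp (-2) * (μ univ).toReal) * Real.exp 2 := mul_lt_mul_of_pos_right h3 (Real.exp_pos 2)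
    _ = (μ univ).toReal := by rw [mul_comm (Real.exp (-2)), mul_assoc, h5, mul_one]

/-- **Numerical window of the volume floor**: `0.973 · 96π² < 32π²√π e^{1/2} < 0.975 · 96π²`, i.e.
a counterexample has `Vol_g(M) > 97.3 %` of `Vol(S⁴(√6)) = 96π² ≈ 947.5` (and the floor itself is
below `97.5 %`, so it does not contradict the round sphere). [folklore] -/
theorem volume_floor_window :
    0.973 * (96 * Real.pi ^ 2) < 32 * Real.pi ^ 2 * Real.sqrt Real.pi * Real.exp (1 / 2) ∧
    32 * Real.pi ^ 2 * Real.sqrt Real.pi * Real.exp (1 / 2) < 0.975 * (96 * Real.pi ^ 2) := by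
  have hπ := Real.pi_pos
  have hs : 0 < Real.sqrt Real.pi := Real.sqrt_pos.mpr hπ
  have hprod : 0 < Real.sqrt Real.pi * Real.exp (1 / 2) := mul_pos hs (Real.exp_pos _)
  have hsq : (Real.sqrt Real.pi * Real.exp (1 / 2)) ^ 2 = Real.pi * Real.exp 1 := by
    rw [mul_pow, Real.sq_sqrt hπ.le, ← Real.exp_nat_mul]; norm_num
  have hpi_lo : 3.141592 < Real.pi := Real.pi_gt_d6
  have hpi_hi : Real.pi < 3.141593 := Real.pi_lt_d6
  have he_lo : 2.7182818283 < Real.exp 1 := Real.exp_one_gt_d9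
  have he_hi : Real.exp 1 < 2.7182818286 := Real.exp_one_lt_d9
  have hlo : (3 * 0.973 : ℝ) ^ 2 < (Real.sqrt Real.pi * Real.exp (1 / 2)) ^ 2 := by rw [hsq]; nlinarith
  have hhi : (Real.sqrt Real.pi * Real.exp (1 / 2)) ^ 2 < (3 * 0.975 : ℝ) ^ 2 := by rw [hsq]; nlinarith
  have hlo' : 3 * 0.973 < Real.sqrt Real.pi * Real.exp (1 / 2) := lt_of_pow_lt_pow_left₀ 2 hprod.le hlo
  have hhi' : Real.sqrt Real.pi * Real.exp (1 / 2) < 3 * 0.975 := lt_of_pow_lt_pow_left₀ 2 (by norm_num) hhi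
  have hp2 : 0 < 32 * Real.pi ^ 2 := by positivity
  constructor
  · calc 0.973 * (96 * Real.pi ^ 2) = 32 * Real.pi ^ 2 * (3 * 0.973) := by ring
      _ < 32 * Real.pi ^ 2 * (Real.sqrt Real.pi * Real.exp (1 / 2)) := mul_lt_mul_of_pos_left hlo' hp2
      _ = 32 * Real.pi ^ 2 * Real.sqrt Real.pi * Real.exp (1 / 2) := by ring
  · calc 32 * Real.pi ^ 2 * Real.sqrt Real.pi * Real.exp (1 / 2)
        = 32 * Real.pi ^ 2 * (Real.sqrt Real.pi * Real.exp (1 / 2)) := by ring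
      _ < 32 * Real.pi ^ 2 * (3 * 0.975) := mul_lt_mul_of_pos_left hhi' hp2
      _ = 0.975 * (96 * Real.pi ^ 2) := by ring

/-! ## §7 Einstein sub-case constants (Gursky–Hitchin dichotomy vs the bar) -/

/-- **A non-round Einstein shrinker on a homotopy 4-sphere misses the bar by a factor ≈ 2.92**:
Gursky 2000 (Thm 1, tree fact `gursky_einstein_homotopySphere_four`) + Hitchin give, for Einstein
`Ric = g/2` on `M ≃ₕ S⁴` not of constant curvature, `Vol ≤ Vol(S⁴(√6))/3 = 32π²`, whence
`∫ e^{-2} dV ≤ 32π² e^{-2} ≈ 42.7 < 124.9`. So in the Einstein sub-case the crux holds with an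
enormous margin; the live case is non-Einstein. [cite: Gursky2000, Thm 1] -/
theorem gursky_bound_lt_threshold :
    Real.exp (-2) * (32 * Real.pi ^ 2) < 32 * Real.pi ^ 2 * Real.sqrt Real.pi * Real.exp (-(3 : ℝ) / 2) := by
  have hπ := Real.pi_pos
  have h3 : (3 : ℝ) < Real.pi := Real.pi_gt_three
  have hs1 : 1 < Real.sqrt Real.pi := by
    rw [show (1 : ℝ) = Real.sqrt 1 by simp]
    exact Real.sqrt_lt_sqrt (by norm_num) (by linarith)
  have he : Real.exp (-2) < Real.exp (-(3 : ℝ) / 2) := Real.exp_lt_exp.mpr (by norm_num)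
  have hpos : 0 < 32 * Real.pi ^ 2 := by positivity
  calc Real.exp (-2) * (32 * Real.pi ^ 2) = 32 * Real.pi ^ 2 * 1 * Real.exp (-2) := by ring
    _ < 32 * Real.pi ^ 2 * Real.sqrt Real.pi * Real.exp (-2) := by
        apply mul_lt_mul_of_pos_right _ (Real.exp_pos _)
        exact mul_lt_mul_of_pos_left hs1 hpos
    _ < 32 * Real.pi ^ 2 * Real.sqrt Real.pi * Real.exp (-(3 : ℝ) / 2) := by
        apply mul_lt_mul_of_pos_left he (by positivity)

/-- **A free `ℤ₂`-quotient of the round shrinker misses the bar**: `48π² e^{-2} ≈ 64.1 < 124.9`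
(`Θ(ℝP⁴) = 3/e² = .406`; relevant to the rung's orbifold bookkeeping, recorded here because the
constant is shared). [cite: CaoHamiltonIlmanen2004, §4] -/
theorem half_round_lt_threshold :
    Real.exp (-2) * (48 * Real.pi ^ 2) < 32 * Real.pi ^ 2 * Real.sqrt Real.pi * Real.exp (-(3 : ℝ) / 2) := by
  have hπ := Real.pi_pos
  -- 48 e^{-2} < 32 √π e^{-3/2}  ⟺  3 < 2 √π e^{1/2}; and 2√π e^{1/2} > 2 · 1.7 · 1.6 > 3.
  have hs : (1.7 : ℝ) < Real.sqrt Real.pi := by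
    rw [Real.lt_sqrt (by norm_num)]
    have := Real.pi_gt_d2; nlinarith
  have he : (1.6 : ℝ) < Real.exp (1 / 2) := by
    have h1 : (1.6 : ℝ) ^ 2 < Real.exp (1 / 2) ^ 2 := by
      rw [← Real.exp_nat_mul]; norm_num
      have := Real.exp_one_gt_d9; linarith
    exact lt_of_pow_lt_pow_left₀ 2 (Real.exp_pos _).le h1
  have h4 : Real.exp (-(3 : ℝ) / 2) = Real.exp (-2) * Real.exp (1 / 2) := by
    rw [← Real.exp_add]; norm_num
  rw [h4]
  have hE := Real.exp_pos (-2 : ℝ)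
  have key : (1.5 : ℝ) < Real.sqrt Real.pi * Real.exp (1 / 2) := by nlinarith
  have hc : 0 < Real.exp (-2) * Real.pi ^ 2 := by positivity
  calc Real.exp (-2) * (48 * Real.pi ^ 2) = (Real.exp (-2) * Real.pi ^ 2) * 48 := by ring
    _ < (Real.exp (-2) * Real.pi ^ 2) * (32 * (Real.sqrt Real.pi * Real.exp (1 / 2))) := by
        apply mul_lt_mul_of_pos_left _ hc; linarith
    _ = 32 * Real.pi ^ 2 * Real.sqrt Real.pi * (Real.exp (-2) * Real.exp (1 / 2)) := by ring

/-! ## §8 The one falsifiable strengthening: dense non-Einstein shrinkers on the STANDARD `S⁴` -/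

/-- **Target for future adversaries** (NOT implied by SPC4, hence genuinely falsifiable, unlike the
crux): every normalised gradient shrinker on the standard `S⁴` whose density clears the bar is Einstein
(`Hess f ≡ 0`; then `f ≡ 2`, `Ric = g/2`, and by Gursky + Kuiper it is the round `S⁴(√6)`). A
counterexample — a NON-Einstein gradient shrinker on `S⁴` with `Θ > .791` — would sink the route's
planned split `HighDensityIsEinstein` and the transfer targets of all four idea cards
(`VarianceBudget` possibly excepted) at once, while leaving the crux itself true on `S⁴`
(`conclusion_round`). STATUS: open. No non-Einstein shrinker on `S⁴` is known at any density; they are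
excluded among rotationally invariant metrics (Kotschwar 2008, arXiv:math/0702597, Thm 1) and — only
numerically — in every cohomogeneity-one symmetry class (Donovan 2025, arXiv:2503.15033 §5.2 and
Conj. 1.5; Buttsworth 2022 for SO(3)×SO(2); this seat's biaxial U(2) scan, NOTES). So any kill of the
LINES must be at least cohomogeneity two or fully asymmetric. [cite: Kotschwar2008, Thm 1] -/
def DenseShrinkerOnSphereIsEinstein : Prop :=
  ∀ (g : PseudoRiemannianMetric (𝓡 4) ∞ (EuclideanSpace ℝ (Fin 4)) (TangentSpace (𝓡 4) : SphereFour → Type _))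
    [g.HasLeviCivita] (f : SphereFour → ℝ) (hg : g.IsRiemannian), Hyps SphereFour g f hg →
    ∀ x : SphereFour, g.hessian f x = 0

/-- Consistency of the target at the model: the round shrinker's potential has vanishing Hessian. [folklore] -/
theorem denseShrinkerOnSphereIsEinstein_round (x : SphereFour) :
    shrinkingSphereFourMetric.hessian (fun _ ↦ (2 : ℝ)) x = 0 :=
  hessian_constFun _ 2 x

/-- The crux specialised to the standard sphere is TRUE outright (identity diffeomorphism), whatever
`(g, f)` is — which is exactly why the crux carries no information about shrinkers on `S⁴` and all
the geometric content sits in `DenseShrinkerOnSphereIsEinstein`-type statements. [folklore] -/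
theorem compactShrinkerGap_on_sphereFour
    (g : PseudoRiemannianMetric (𝓡 4) ∞ (EuclideanSpace ℝ (Fin 4)) (TangentSpace (𝓡 4) : SphereFour → Type _))
    [g.HasLeviCivita] (f : SphereFour → ℝ) (hg : g.IsRiemannian) (_h : Hyps SphereFour g f hg) :
    Nonempty (SphereFour ≃ₘ⟮𝓡 4, 𝓡 4⟯ (Metric.sphere (0 : EuclideanSpace ℝ (Fin 5)) 1)) :=
  ⟨Diffeomorph.refl _ _ _⟩

/-! ## §9 Calibration on the one non-Einstein compact 4-d shrinker with a closed form (Koiso–Cao)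

DATA (this seat, `folder/koiso_cao.py` + `koiso_cao_output.txt`, attached as item evidence; pure
quadrature, no ODE shooting): via Donovan 2025 Lemma 5.10/5.12 the Koiso–Cao shrinker on
`ℂP²#(−ℂP²)` is `g = dt² + (ff′)²σ̃₁² + f²(σ̃₂²+σ̃₃²)`, `(f′)² = G(f)` explicit, `f² ∈ [2, 6]`,
`u′ = C f f′` with `−C = −0.5276195` the negative root of `e^{2x}(3x²−4x+2) + x² − 2`
(= Dancer–Hall–Wang's `ū = −0.5276`). In the CRUX normalisation (`Ric + Hess f = g/2`,
`R + |∇f|² = f`):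

* `Θ = 0.517868` (CHI table: `3.826/e² = .5178` ✓ to 4 digits — independent re-derivation);
* `Vol = 64π² = (2/3)·Vol(S⁴(√6))`, `Z = ∫e^{-f} = 81.78 < 124.90` (misses the bar by 35 %),
  `D = ∫(R−2)² = 58.29`, `∫R = 2·Vol` ✓, weighted mean `∫f e^{-f}/Z = 2.000000` ✓ (§6 input),
  Jensen `Z ≤ e^{-2}Vol = 85.49` ✓, CRZ-sharp `D ≤ ½(e^{f_max}Z − Vol) = 196.3` ✓,
  CRZ Thm 2 `Vol(5 − e^{osc}) = 1343.7 ≤ 384π²` ✓;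
* `f_min = R(bolt₁) = 1.4724`, `f_max = R_max = 2.5276`, `osc f = 1.0552 = 2C`.

USE: (i) the cgy-variance-pivot line's bookkeeping (`∫R = 2V`, Jensen, CRZ-sharp, the
`(V, Z, D)` dictionary) is consistent on a non-Einstein example — its "cheapest falsifier (i)"
passes; (ii) for `stub_potentialLeThree` (`f ≤ 3` on dense homotopy-sphere shrinkers): every KNOWN
compact 4-d shrinker has `f_max ≤ 2.53` (Einstein ones `f ≡ 2`; Koiso–Cao `2.528`), so the stub is
not contradicted by any example, dense or not — but nothing ties `f_max` to the density either; it
stays OPEN and falsifiable only on the standard `S⁴` (§8).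
-/

/-! ## §10 Adversarial pass over the three filed LINES (Lines/*.lean, 2026-08-15T23:3xZ) — no kill

Checked as the standing adversary (paper; the stubs are provers' property, nothing is edited):

* `cgy-variance-pivot`: STUB 6 (ii) "CRZ-sharp" `D ≤ ½(e^{c}Z − V)` for `c ≥ sup f` — RE-DERIVED and
  correct: with `φ(t) = ∫_{f<t}⟨∇R,∇f⟩`, `ψ(t) = ∫_{f<t}(R − 2|Ric|²) ≤ ½Vol{f<t}` (`R − 2|Ric|² ≤
  ½R(2−R) ≤ ½`), `φ′ = φ + ψ` gives `D = φ(b) = e^{b}∫_a^b ψe^{-t} ≤ ½e^{b}∫_a^b Vol{f<t}e^{-t}dt =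
  ½e^{b}(Z − Ve^{-b})` (Fubini), `b = f_max`; equality at the round shrinker. STUBS 2, 3 are standard
  identities (`∫|Ric|² = ½∫R² − V` re-derived in the route notes); STUB 7 (`f ≤ 3`) and STUB 1 are open,
  falsifiable only on the standard `S⁴` (§8); Koiso–Cao data (§9) are consistent with all of them.
* `decay-climb-numax` / `density-summit-stability`: the hidden inputs hold on paper —
  (a) an orbifold point of order `|Γ|` forces `Θ ≤ 1/|Γ| ≤ ½ < .791` because `log Θ = μ(g,1) = ν(g) =
  inf_τ μ(g,τ) ≤ lim_{τ→0} μ(g,τ) = −log|Γ|` (Carrillo–Ni at `τ = 1`, concentration at the cone point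
  as `τ → 0`); (b) `stub_entropyDominance` silently contains "sup over `R > 0` metrics on `S⁴` of `ν`
  equals `ν(round) = log 6 − 2`": NOT refutable by the constant-test-function bound
  `ν(g) ≤ log(V·R̄²/64π²) − 2` (which exceeds `log 6 − 2` as soon as the Yamabe quotient `Q(g,1)²
  = (∫R)²/V > 384π² = Y(S⁴)²`, i.e. for most metrics), and its 3-dimensional analogue
  (`ν(g) ≤ log Θ(S³)` for every `R > 0` metric on a closed 3-manifold) is a THEOREM by Perelman's
  flow + the 3-d shrinker classification — so (b) is exactly "the top of the 4-d density table is
  complete", the route's thesis, not an extra assumption; (c) `stub_maximiserIsEinstein` /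
  `stub_dominantShrinkerEinstein` = Cao's stability conjecture in the class `b₂ = 0`, open, falsifiable
  only on the standard `S⁴` (§8). No misstatement found in the eight stub signatures read.
-/

/-! ## §11 The CRZ sub-line's hypothesis `PotentialLeThree` (`f ≤ 3`): load-bearing closedness,
the `f_max` window, and the constant `3` -/

/-! STATUS OF `f ≤ 3` IN PRINT (v7, page-read this cycle). No theorem bounds `sup f = sup R` on a compact
4-d shrinker by its entropy/density: the available a-priori sup bounds are `f ≤ (d(x,p)/2 + √(n/2))²`
(Cao–Zhou 2010, `p` a minimum point of `f`) combined with a diameter bound, and the only unconditional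
diameter bound (J.-Y. Wu 2020, arXiv:2008.02893, Thm. 1.1, p. 4: `diam ≤ c₁(n,μ)∫R^{(n−1)/2} dv` with
`c₁(n,μ) = 4·max{w_n⁻¹, (4π)^{-n/2} e^{2ⁿ·17 − μ − n}}`, i.e. `e^{272−μ−4}` in dimension 4) is lossy by
~100 orders of magnitude. Lower bounds only push the other way (`f_max > 2` unless Einstein, below). A
laboratory where `3` is visibly NOT a universal constant — QUANTIFIED this cycle (v7, this seat,
`numerics/orbifold_family_v7.py`, attached as `numerics_gen3_orbifolds.txt`): Donovan 2025
(arXiv:2503.15033, Lemma 5.10/5.12, pp. 22–23) gives, for every `(n, q₁, q₂)` with `max qᵢ > n/2`, compact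
non-Einstein `U(2)`-invariant Kähler shrinking soliton ORBIFOLDS on `M_n` (cone angles `2π/qᵢ` along the two
singular `ℂP¹`'s, principal orbit `S³/ℤ_n`; closed-form first integral `(f′)² = G(f)`, `u′ = C f f′`,
`f² ∈ [4 − 2n/q₁, 4 + 2n/q₂]`; the cone-angle slopes `(ff′)′ = ±n/qᵢ` at the ends come out exactly in the
quadrature, certifying the identification). Scan `n ≤ 6`, `qᵢ ≤ 8` (296 solitons, crux normalisation, all
identities `∫R = 2V`, weighted mean `2.000` checked per member): `f_max = R_max > 3` for 144/296 (max `12.5`;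
e.g. `(n,q₁,q₂) = (1,2,1)`: `f_max = 3.91`, `(2,2,1)`: `4.39`); EVERY member is sparse (`Θ ≤ .518 =`
Koiso–Cao `= (1,1,1)`; among `f_max > 3`: `Θ ≤ .336`); and STUB 1's raw inequality `D < 2V − 96π²` holds for
exactly ONE of the 296 (Koiso–Cao) — e.g. `(3,2,1)`: `V = 66π² > 48π²`, `D = 111π² ≫ 2V − 96π² = 36π²`
(`D/V = 1.68`). Empirical envelope in this family: `Θ ≤ .34` as soon as `f_max ≥ 2.6`. So (i) neither
`f ≤ 3` nor the budget is a structural law of compact shrinking solitons — both fail generically among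
(sparse, orbifold) ones; (ii) if `PotentialLeThree`/STUB 1 hold they are DENSITY phenomena, and nothing in
print connects `sup R` or `D` to `Θ`; (iii) conversely nothing here threatens them: the bar `.791` sits a
factor `2.4` above every non-Einstein data point. -/

/-- `PotentialLeThree` of `Lines/cgy-variance-pivot.lean` (crux data ⇒ `f ≤ 3` pointwise) with
`[CompactSpace M]` and `M ≃ₕ S⁴` deleted, all other sub-terms verbatim (bundled as `Hyps`). [folklore] -/
def PotentialLeThreeWithoutCompactHomotopy : Prop :=
  ∀ (M : Type) [TopologicalSpace M] [T2Space M] [SecondCountableTopology M]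
    [ChartedSpace (EuclideanSpace ℝ (Fin 4)) M] [IsManifold (𝓡 4) ∞ M] [T3Space M]
    [MeasurableSpace M] [BorelSpace M],
    ∀ (g : PseudoRiemannianMetric (𝓡 4) ∞ (EuclideanSpace ℝ (Fin 4)) (TangentSpace (𝓡 4) : M → Type _))
      [g.HasLeviCivita] (f : M → ℝ) (hg : g.IsRiemannian), Hyps M g f hg → ∀ x : M, f x ≤ 3

/-- The Gaussian potential at the point `4·e₀ ∈ ℝ⁴` is `|4e₀|²/4 = 4`. [folklore] -/
theorem gaussianPotential_single_four :
    gaussianPotential (EuclideanSpace.single (0 : Fin 4) (4 : ℝ)) = 4 := by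
  have h : ‖EuclideanSpace.single (0 : Fin 4) (4 : ℝ)‖ = 4 := by
    rw [EuclideanSpace.single, PiLp.norm_single]
    norm_num
  rw [gaussianPotential, h]
  norm_num

/-- **LOAD-BEARING (closedness) for `f ≤ 3`**: with compactness and `M ≃ₕ S⁴` dropped,
`PotentialLeThree` is FALSE — the Gaussian shrinker `(ℝ⁴, δ, |x|²/4)` satisfies every analytic
hypothesis incl. the density floor (`Θ = 1`) and has `f(4e₀) = 4 > 3`; indeed `f` is proper
(`f ~ d(x,p)²/4`, Cao–Zhou 2010) on EVERY non-compact shrinker, so a sup bound on `f` is an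
intrinsically compact phenomenon (`f_max = R_max` there). Any proof of `PotentialLeThree` must use
closedness beyond the soliton identities. [cite: CaoHamiltonIlmanen2004, §4] -/
theorem potentialLeThree_false_without_compactHomotopy : ¬ PotentialLeThreeWithoutCompactHomotopy := by
  intro h
  have h4 := h EuclideanFour (euclideanMetric EuclideanFour) gaussianPotential isRiemannian_euclideanMetric
    hyps_gaussian (EuclideanSpace.single (0 : Fin 4) (4 : ℝ))
  rw [gaussianPotential_single_four] at h4
  norm_num at h4

/-- **Lower end of the `f_max` window** (measure-theoretic core): on any measure space, if
`e^{-f}` has positive integral, `∫ f e^{-f} = 2∫e^{-f}` (the integrated identity `Δ_f f = 2 − f` of a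
closed normalised 4-d shrinker — prover input) and `f ≤ c` everywhere, then `2 ≤ c`. So on a closed
normalised shrinker `f_max ≥ 2 = n/2`, and `PotentialLeThree` pins `f_max ∈ [2, 3]`.
[cite: CaoHamiltonIlmanen2004, §4] -/
theorem two_le_of_potential_le {α : Type*} [MeasurableSpace α] (μ : Measure α) (f : α → ℝ) (c : ℝ)
    (h₁ : Integrable (fun x ↦ Real.exp (-f x)) μ)
    (h₂ : Integrable (fun x ↦ f x * Real.exp (-f x)) μ)
    (hpos : 0 < ∫ x, Real.exp (-f x) ∂μ)
    (hid : ∫ x, f x * Real.exp (-f x) ∂μ = 2 * ∫ x, Real.exp (-f x) ∂μ)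
    (hc : ∀ x, f x ≤ c) : 2 ≤ c := by
  by_contra hlt
  push Not at hlt
  have hle : ∫ x, f x * Real.exp (-f x) ∂μ ≤ ∫ x, c * Real.exp (-f x) ∂μ :=
    integral_mono h₂ (h₁.const_mul c) fun x ↦
      mul_le_mul_of_nonneg_right (hc x) (Real.exp_pos _).le
  rw [integral_const_mul, hid] at hle
  nlinarith

/-- **Equality case at the lower end**: under the same identity, `f ≤ 2` everywhere forces `f = 2`
almost everywhere (the Einstein case `Hess f ≡ 0`): the integrand `(2 − f)e^{-f} ≥ 0` has integral
`0`. So a NON-Einstein closed normalised shrinker has `f_max = R_max > 2` strictly (Koiso–Cao: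
`2.5276`, §9). [cite: CaoHamiltonIlmanen2004, §4] -/
theorem ae_eq_two_of_potential_le_two {α : Type*} [MeasurableSpace α] (μ : Measure α) (f : α → ℝ)
    (h₁ : Integrable (fun x ↦ Real.exp (-f x)) μ)
    (h₂ : Integrable (fun x ↦ f x * Real.exp (-f x)) μ)
    (hid : ∫ x, f x * Real.exp (-f x) ∂μ = 2 * ∫ x, Real.exp (-f x) ∂μ)
    (hc : ∀ x, f x ≤ 2) : f =ᵐ[μ] fun _ ↦ 2 := by
  have hnn : 0 ≤ᵐ[μ] fun x ↦ (2 - f x) * Real.exp (-f x) :=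
    ae_of_all _ fun x ↦ mul_nonneg (by linarith [hc x]) (Real.exp_pos _).le
  have hint : Integrable (fun x ↦ (2 - f x) * Real.exp (-f x)) μ := by
    have : (fun x ↦ (2 - f x) * Real.exp (-f x)) = fun x ↦ 2 * Real.exp (-f x) - f x * Real.exp (-f x) := by
      funext x; ring
    rw [this]
    exact (h₁.const_mul 2).sub h₂
  have hzero : ∫ x, (2 - f x) * Real.exp (-f x) ∂μ = 0 := by
    have : (fun x ↦ (2 - f x) * Real.exp (-f x)) = fun x ↦ 2 * Real.exp (-f x) - f x * Real.exp (-f x) := by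
      funext x; ring
    rw [this, integral_sub (h₁.const_mul 2) h₂, integral_const_mul, hid]
    ring
  have hae := (integral_eq_zero_iff_of_nonneg_ae hnn hint).mp hzero
  filter_upwards [hae] with x hx
  have hx' : (2 - f x) * Real.exp (-f x) = 0 := hx
  rcases mul_eq_zero.mp hx' with h | h
  · linarith
  · exact absurd h (Real.exp_pos _).ne'

/-- **The constant `3` is (almost) the limit of the CRZ arithmetic**: the sub-line closes the budget
from `Z₀ < Z ≤ e^{-2}V` and `D ≤ ½(e^{c}Z − V)` for `c = 3` (`varianceBudget_arith` in the skeleton),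
and the same three inequalities STOP implying `D < 2V − 96π²` as soon as `e^{c−2} > 5 − 6/(√π e^{1/2})
= 2.9468`, i.e. `c > c* = 3.0807`. Witness at `c = 3.1`: `V = 94π²`, `Z = e^{-2}V` (admissible:
`94 > 32√π e^{1/2} = 93.51`), `D = ½(e^{3.1}Z − V) = 47π²(e^{1.1} − 1) ≥ 47π² · 1.99 > 92π² = 2V − 96π²`.
So `PotentialLeThree` cannot be relaxed to `f ≤ 3.1` inside this sub-line; the slack at `c = 3` is
`< 3 %`. [folklore] -/
theorem crz_arith_fails_at_exp_3_1 : ∃ V Z D : ℝ,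
    32 * Real.pi ^ 2 * Real.sqrt Real.pi * Real.exp (-(3 : ℝ) / 2) < Z ∧
    Z ≤ Real.exp (-2) * V ∧
    D ≤ 1 / 2 * (Real.exp (31 / 10) * Z - V) ∧
    ¬ (D < 2 * V - 96 * Real.pi ^ 2) := by
  refine ⟨94 * Real.pi ^ 2, Real.exp (-2) * (94 * Real.pi ^ 2),
    1 / 2 * (Real.exp (31 / 10) * (Real.exp (-2) * (94 * Real.pi ^ 2)) - 94 * Real.pi ^ 2), ?_, le_rfl, le_rfl, ?_⟩
  · -- `32 √π e^{-3/2} < 94 e^{-2}` ⟸ `√π e^{1/2} < 94/32`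
    have hπ := Real.pi_pos
    have hs : Real.sqrt Real.pi < 1.7725 := by
      rw [Real.sqrt_lt' (by norm_num)]
      have := Real.pi_lt_d6; nlinarith
    have he : Real.exp (1 / 2) < 1.6488 := by
      have h : Real.exp (1 / 2) ^ 2 < (1.6488 : ℝ) ^ 2 := by
        rw [← Real.exp_nat_mul]; norm_num
        have := Real.exp_one_lt_d9; linarith
      exact lt_of_pow_lt_pow_left₀ 2 (by norm_num) h
    have hprod : Real.sqrt Real.pi * Real.exp (1 / 2) < 1.7725 * 1.6488 :=
      mul_lt_mul'' hs he (Real.sqrt_nonneg _) (Real.exp_pos _).le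
    have hE : Real.exp (-(3 : ℝ) / 2) = Real.exp (-2) * Real.exp (1 / 2) := by
      rw [← Real.exp_add]; norm_num
    rw [hE]
    have h2 := Real.exp_pos (-2 : ℝ)
    have hp2 : 0 < Real.pi ^ 2 := by positivity
    nlinarith [mul_pos h2 hp2]
  · -- `47π²(e^{1.1} − 1) ≥ 92π²` ⟸ `e^{1.1} ≥ e·1.1 ≥ 2.99`
    intro hlt
    have hE : Real.exp (31 / 10) * Real.exp (-2) = Real.exp (11 / 10) := by
      rw [← Real.exp_add]; norm_num
    have h11 : Real.exp (11 / 10 : ℝ) = Real.exp 1 * Real.exp (1 / 10) := by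
      rw [← Real.exp_add]; norm_num
    have hlow : (2.99 : ℝ) < Real.exp (11 / 10) := by
      rw [h11]
      have h1 := Real.exp_one_gt_d9
      have h2 : (1 / 10 : ℝ) + 1 ≤ Real.exp (1 / 10) := Real.add_one_le_exp _
      nlinarith [Real.exp_pos (1 / 10 : ℝ)]
    have hp2 : 0 < Real.pi ^ 2 := by positivity
    have key : 1 / 2 * (Real.exp (31 / 10) * (Real.exp (-2) * (94 * Real.pi ^ 2)) - 94 * Real.pi ^ 2)
        = 47 * Real.pi ^ 2 * (Real.exp (31 / 10) * Real.exp (-2) - 1) := by ring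
    rw [key, hE] at hlt
    nlinarith

/-! ## §12 The variance budget over the compact shrinker zoo: violated, but only at density ≤ 3/e² -/

/-- **Einstein calibration of STUB 1**: for an Einstein normalised shrinker (`f ≡ 2`, `R ≡ 2`,
`D = 0`) the budget `D < 2V − 96π²` is exactly `Vol > 48π²`, i.e. `Θ = Vol·e^{-2}/(16π²) > 3/e² ≈
0.406`. PAPER table (Vol = 16π²e²Θ): `S⁴(√6)` 96π² ✓, `ℂP²` 72π² ✓, `S²×S²` 64π² ✓, Page ≈ 61π² ✓ (CHI table `.517`),
Kähler–Einstein del Pezzo surfaces `ℂP²#k(−ℂP²)`, `3 ≤ k ≤ 8`, of degree `d = 9 − k ≤ 6` (`Vol = 2π²c₁²/λ² =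
8π²d ≤ 48π²`) ✗ and `ℝP⁴(√6)` (`Vol = 48π²`) ✗ — `d = 6` and `ℝP⁴` with EQUALITY at `48π²`. So the raw inequality of STUB 1 is NOT a
universal compact-shrinker inequality: it fails in the zoo, but only at `Θ ≤ .406 < .791`, where the
density floor (Jensen: `Vol > 32π²√π e^{1/2} ≈ 93.5π²`, §6) has long excluded them. Consequence for
provers: the density hypothesis must enter any proof of STUB 1 quantitatively; for non-Einstein data
it must bound `D`, and the only printed `D`-bound is CRZ's `D ≤ ½(e^{f_max}Z − V)` (§11). [folklore] -/
theorem einstein_budget_iff (V : ℝ) : (0 : ℝ) < 2 * V - 96 * Real.pi ^ 2 ↔ 48 * Real.pi ^ 2 < V := by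
  constructor <;> intro h <;> linarith

/-- The two equality cases of the zoo (`ℝP⁴(√6)`, KE del Pezzo of degree 6: `Vol = 48π²`, `D = 0`)
sit exactly ON the budget line: `¬ (0 < 2·48π² − 96π²)`. [folklore] -/
theorem budget_fails_at_halfRound : ¬ ((0 : ℝ) < 2 * (48 * Real.pi ^ 2) - 96 * Real.pi ^ 2) := by
  intro h; linarith

/-- **Jensen puts every dense shrinker far inside the Einstein-safe region**: `32π²√π e^{1/2} > 48π²`
with a factor `≈ 1.95`, so the Einstein sub-case of STUB 1 is automatic (this is the arithmetic
behind "automatic in the Einstein sub-case" in the skeleton's docstring). [folklore] -/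
theorem jensen_floor_gt_halfRound : 48 * Real.pi ^ 2 < 32 * Real.pi ^ 2 * Real.sqrt Real.pi * Real.exp (1 / 2) := by
  have hπ := Real.pi_pos
  have hs : (1.7 : ℝ) < Real.sqrt Real.pi := by
    rw [Real.lt_sqrt (by norm_num)]
    have := Real.pi_gt_d2; nlinarith
  have he : (1.6 : ℝ) < Real.exp (1 / 2) := by
    have h1 : (1.6 : ℝ) ^ 2 < Real.exp (1 / 2) ^ 2 := by
      rw [← Real.exp_nat_mul]; norm_num
      have := Real.exp_one_gt_d9; linarith
    exact lt_of_pow_lt_pow_left₀ 2 (Real.exp_pos _).le h1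
  have key : (1.5 : ℝ) < Real.sqrt Real.pi * Real.exp (1 / 2) := by nlinarith
  have hp : 0 < 32 * Real.pi ^ 2 := by positivity
  nlinarith

/-- **Non-Einstein calibration** (Koiso–Cao, §9 data, PAPER): `D = 58.3 < 2V − 96π² = 315.8` — the one
non-Einstein compact 4-d shrinker with a closed form satisfies STUB 1's inequality with a factor `5.4`,
although it is far below the density bar (`Θ = .518`). Budget violators need mean `(R − 2)² ≳ 2 − 96π²/V
≥ 0.97` (with `∫R dV = 2V` exactly): a scalar curvature spread of order one around its mean `2` over
most of the volume, while beating both `S⁴` (`R ≡ 2`) and the cylinder (`R ≡ 3/2`, `(R−2)² ≡ ¼`) in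
density — no known or conjectured compact shrinker is anywhere near this regime. [folklore] -/
theorem budget_violation_threshold (V D : ℝ) (hV : 0 < V) :
    ¬ (D < 2 * V - 96 * Real.pi ^ 2) ↔ 2 - 96 * Real.pi ^ 2 / V ≤ D / V := by
  have h : 2 - 96 * Real.pi ^ 2 / V = (2 * V - 96 * Real.pi ^ 2) / V := by
    field_simp
  rw [not_lt, h, div_le_div_iff_of_pos_right hV]

/-! ## §13 Typed audit of the RESHAPED picked skeleton (Lines/cgy-variance-pivot.lean, 7 stubs, 2026-08-15T23:45Z) — no misstatement

Read symbol by symbol against the tree definitions (this seat, gen 3):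

* Normalisations are mutually consistent: `g.weylEnergy = ∫ Σ W_{ijkl}² dV` is the `(0,4)`-norm
  (`WeylEnergy.lean`, CGY Remark 2), `σ₂(A) = −½|E|² + R²/24` with `A = Ric − (R/6)g`
  (`sigma2WeylSchouten_eq`, PROVED), so STUB 5 (`8π²χ = ¼ weylEnergy + ∫σ₂`) is CGB in CGY's form (0.4)
  and STUB 6 (`changGurskyYang_sphere_four`, threshold `32π² ≤ 16π²χ`) is Thm. A's simply-connected
  `R > 0` case verbatim — the round-sphere check `chernGaussBonnet_roundMetric_sphere_four` pins only the
  `σ₂` normalisation (`W = 0` there), but the `|W|²` normalisation is pinned by the definition itself.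
  Calibration with `W ≠ 0` (PAPER): `ℂP²` (FS, `Ric = g/2`): `¼∫|W|²_T = 12π²τ·… = 12π²`, `∫σ₂ = ∫R²/24 =
  12π²`, sum `24π² = 8π²·3` ✓; `S²×S²`: `∫|W|²_T = 256π²/3`, `∫σ₂ = 32π²/3`, `¼·256/3 + 32/3 = 32 = 8·4` ✓.
* STUB 2 (A) `dR = 2 Ric(♯df, ·)` and (B) `ΔR = g⁻¹(dR, df) + R − 2|Ric|²` re-derived with `λ = ½`
  (`div Ric = ½dR`, `div Hess f = d(Δf) + Ric(♯df,·)`, `R + Δf = 2`; `Δ_f R = 2λR − 2|Ric|²`);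
  `g.normSq x (g.ricci x) = g^{ik}g^{jl}R_{ij}R_{kl}` (`PseudoRiemannianMetric.normSq`) ✓; no `[CompactSpace]`
  needed (pointwise) ✓; empty `M` vacuous ✓.
* STUB 3 constants: `∫R = 2V`, `∫g⁻¹(dR,df) = −∫RΔf = ∫R² − 4V`, `∫|Ric|² = ½∫R² − V`, `D = ∫R² − 4V`,
  `∫|E|² = D/4`, `∫σ₂ = V/6 − D/12` ✓ (round: `16π²` ✓; Koiso–Cao §9: `V/6 − D/12 = 105.3 − 4.9 = 100.4`
  vs CGB `8π²χ − ¼∫|W|²` with `χ = 4`: `∫|W|²_T = 4(315.8 − 100.4) = 861.6 = 87.3π²` — positive ✓, and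
  `> 16π²χ = 64π²` ✓ consistent with CGY NOT applying to `ℂP²#(−ℂP²)`).
  INDEPENDENT CROSS-CHECK of gen 2's `D = 58.29` (v7): on a Kähler surface `|W⁺|²_E = R²/24`, so the
  signature formula `12π²τ = ∫(|W⁺|² − |W⁻|²)_E` gives `∫|W|²_T = (D + 4V)/3 − 48π²τ`; for Koiso–Cao
  (`τ = 0`): `(58.29 + 2526.6)/3 = 861.6` ✓ — the same number, from a different identity. (For Kähler
  shrinkers the topological identities `V = 8π²c₁² = 8π²(2χ + 3τ)` absorb everything else: `D` itself is
  NOT determined by `χ, τ` — it needs the metric.)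
* STUB 4 (`R > 0` from (B) alone): min point gives `R_min ≥ 2|Ric|² ≥ 0`; `(Δ_f − 1)R = −2|Ric|² ≤ 0`
  with minimum value `0` ⇒ strong minimum principle applies whatever the sign bookkeeping of the
  zeroth-order term (min value is `0`); `R ≡ 0` on a component ⇒ `|Ric|² ≡ 0` by (B) ⇒ `Δf ≡ 2`,
  impossible at `f`'s maximum on the compact component ✓. Disconnected / empty `M` harmless.
* STUB 7 (Jensen) = §6 ✓. STUB 1 / `PotentialLeThree`: Bochner integrals of continuous functions on a
  compact manifold against a finite measure — no junk-`0` escape; `M ≃ₕ S⁴` non-empty connected ✓.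
* `CRZSharpBound` re-derived (v5 §10) ✓; sharper PAPER form recorded for provers:
  `D ≤ ½∫_M R(2 − R)(e^{f_max − f} − 1) dV` (keep the sign of `R − R²/2` instead of bounding it by `½`;
  the integrand is negative where `R > 2`). NUMERICS (v7, this seat, `numerics/koiso_cao_v7.py`, pure
  quadrature of Donovan's closed form, attached as `numerics_gen3_koisocao.txt`; reproduces gen 2's §9 data
  to all digits with `∫R = 2V`, `∫Δu = 0`, weighted mean `2.000000`, CGB = Kähler identity `861.64` all
  checking): on Koiso–Cao `D = 58.29`, CRZ-sharp `½(e^{f_max}Z − V) = 196.25` (LOSS FACTOR `3.37`), the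
  sign-kept form `= 70.17` (loss factor `1.20`; the residual loss is the dropped `2|E|²`). So the CRZ
  bookkeeping itself is nearly lossless once the sign of `R(2−R)` is kept; the sub-line's entire exposure is
  the sup bound `f_max` (ceiling `c* = 3.0807` for the crude form, §11).

VERDICT: all seven stubs and both named hypotheses are faithfully typed; the line's entire open content
is STUB 1, reachable inside the CRZ sub-line only through an `f_max` bound `≤ c* = 3.0807` (§11).
-/

/-! ## §14 (v8) The printed scalar toolkit is complete up to ONE scalar — and admits violators

LANDED as `Theorems/CompactShrinkerGap/Negative/ScalarToolkitAdmitsViolator.lean` (p74849; also contains the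
positive-orientation arithmetic `budget_of_crz_of_fmax_le_three`, `budget_of_bhatiaDavis_of_fmax_le`). Copied here so
that the claim is kernel-checked inside the disproof file. THE TOOLKIT, in `V = Vol`, `Z = ∫e^{-f}dV`, `D = ∫(R−2)²dV`,
`fmax = sup f = sup R`, `fmin = inf f`, `Rmin = inf R`: (T1) `Z₀ < Z`; (T2) Jensen `Z ≤ e^{-2}V`; (T3) `e^{-fmax}V ≤ Z ≤
e^{-fmin}V`; (T4) `0 < Rmin ≤ fmin < 2 < fmax`; (T5) CRZ coarea `D ≤ ½(e^{fmax}Z − V)`; (T6) CRZ Thm 1 (χ = 2)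
`D ≤ ½V(e^{osc} − 1)`; (T7) CRZ Thm 2 ⟺ Gursky `∫σ₂ ≤ 16π²` ⟺ CGB + `∫|W|² ≥ 0`: `2V − 192π² ≤ D`; (T8) Catino
pinching (non-round branch) `18V − 1536π² < 15D`; (T9) Bhatia–Davis `D ≤ V(fmax − 2)(2 − Rmin)`; (T10) signs.
CRZ Thm 1/Thm 2 re-read this cycle from the materialised arXiv:2203.14916 p. 4 (Thm 1: `8π²χ ≥ ∫|W|² +
V(5 − e^{f_max − f_min})/24`, `=` iff Einstein; Thm 2: `V(5 − e^{osc f}) ≤ 384π²`, `=` iff `S⁴(√6)`, and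
`≤ Y(M,[g])²`); in `(V, D)` both are the lines recorded in (T6), (T7).
-/

/-- `32 √π e^{-3/2} < 0.99 · 95 · e^{-2}` (the witness's Gaussian mass clears the bar:
`√π e^{1/2} < 1.7725 · 1.6488 < 2.9391`). [folklore] -/
theorem densityFloor_lt_witness :
    32 * Real.pi ^ 2 * Real.sqrt Real.pi * Real.exp (-(3 : ℝ) / 2) <
      99 / 100 * (Real.exp (-2) * (95 * Real.pi ^ 2)) := by
  have hπ := Real.pi_pos
  have hp2 : 0 < Real.pi ^ 2 := by positivity
  have hs : Real.sqrt Real.pi < 1.7725 := by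
    rw [Real.sqrt_lt' (by norm_num)]
    have := Real.pi_lt_d6; nlinarith
  have he : Real.exp (1 / 2) < 1.6488 := by
    have h2 : Real.exp (1 / 2) ^ 2 < (1.6488 : ℝ) ^ 2 := by
      rw [← Real.exp_nat_mul]; norm_num
      have := Real.exp_one_lt_d9; linarith
    exact lt_of_pow_lt_pow_left₀ 2 (by norm_num) h2
  have hprod : Real.sqrt Real.pi * Real.exp (1 / 2) < 1.7725 * 1.6488 :=
    mul_lt_mul'' hs he (Real.sqrt_nonneg _) (Real.exp_pos _).le
  have hE : Real.exp (-(3 : ℝ) / 2) = Real.exp (-2) * Real.exp (1 / 2) := by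
    rw [← Real.exp_add]; norm_num
  rw [hE]
  have h2 := Real.exp_pos (-2 : ℝ)
  nlinarith [mul_pos h2 hp2]

/-- **The witness**: the tuple `(V, Z, D, fmax, fmin, Rmin) = (95π², 0.99e^{-2}·95π², 100π², 4, 1, ½)`
satisfies every conjunct (T1)–(T10) of the printed scalar toolkit AND violates the variance budget:
`2V − 96π² = 94π² ≤ 100π² = D` (last conjunct). [cite: ChengRibeiroZhou2022, Thm. 1, Thm. 2 and §3.2] -/
theorem scalarToolkit_witness :
    -- (T1)
    32 * Real.pi ^ 2 * Real.sqrt Real.pi * Real.exp (-(3 : ℝ) / 2) <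
        99 / 100 * (Real.exp (-2) * (95 * Real.pi ^ 2)) ∧
    -- (T2)
    99 / 100 * (Real.exp (-2) * (95 * Real.pi ^ 2)) ≤ Real.exp (-2) * (95 * Real.pi ^ 2) ∧
    -- (T3)
    (Real.exp (-4) * (95 * Real.pi ^ 2) ≤ 99 / 100 * (Real.exp (-2) * (95 * Real.pi ^ 2)) ∧
      99 / 100 * (Real.exp (-2) * (95 * Real.pi ^ 2)) ≤ Real.exp (-1) * (95 * Real.pi ^ 2)) ∧
    -- (T4)
    ((0 : ℝ) < 1 / 2 ∧ (1 / 2 : ℝ) ≤ 1 ∧ (1 : ℝ) < 2 ∧ (2 : ℝ) < 4) ∧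
    -- (T5)
    100 * Real.pi ^ 2 ≤ 1 / 2 * (Real.exp 4 * (99 / 100 * (Real.exp (-2) * (95 * Real.pi ^ 2))) - 95 * Real.pi ^ 2) ∧
    -- (T6)
    100 * Real.pi ^ 2 ≤ 1 / 2 * (95 * Real.pi ^ 2) * (Real.exp (4 - 1) - 1) ∧
    -- (T7)
    2 * (95 * Real.pi ^ 2) - 192 * Real.pi ^ 2 ≤ 100 * Real.pi ^ 2 ∧
    -- (T8)
    18 * (95 * Real.pi ^ 2) - 1536 * Real.pi ^ 2 < 15 * (100 * Real.pi ^ 2) ∧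
    -- (T9)
    100 * Real.pi ^ 2 ≤ 95 * Real.pi ^ 2 * (4 - 2) * (2 - 1 / 2) ∧
    -- (T10)
    ((0 : ℝ) ≤ 100 * Real.pi ^ 2 ∧ (0 : ℝ) < 95 * Real.pi ^ 2) ∧
    -- the budget is VIOLATED
    2 * (95 * Real.pi ^ 2) - 96 * Real.pi ^ 2 ≤ 100 * Real.pi ^ 2 := by
  have hπ := Real.pi_pos
  have hp2 : 0 < Real.pi ^ 2 := by positivity
  have he1 : 2.7182818283 < Real.exp 1 := Real.exp_one_gt_d9
  have hE2 : Real.exp 2 = Real.exp 1 ^ 2 := by rw [← Real.exp_nat_mul]; norm_num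
  have he2 : 7.38 < Real.exp 2 := by rw [hE2]; nlinarith [Real.exp_pos (1 : ℝ)]
  have he3 : (3 : ℝ) + 1 ≤ Real.exp 3 := Real.add_one_le_exp 3
  have hm2 := Real.exp_pos (-2 : ℝ)
  have hm1 := Real.exp_pos (-1 : ℝ)
  have E42 : Real.exp 4 * Real.exp (-2) = Real.exp 2 := by rw [← Real.exp_add]; norm_num
  have E2m2 : Real.exp 2 * Real.exp (-2) = 1 := by rw [← Real.exp_add]; norm_num
  have Em4 : Real.exp (-4) = Real.exp (-2) * Real.exp (-2) := by rw [← Real.exp_add]; norm_num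
  have hV95 : 0 < 95 * Real.pi ^ 2 := by positivity
  refine ⟨densityFloor_lt_witness, ?_, ⟨?_, ?_⟩, ⟨by norm_num, by norm_num, by norm_num, by norm_num⟩,
    ?_, ?_, ?_, ?_, ?_, ⟨by positivity, by positivity⟩, ?_⟩
  · -- (T2) `0.99 e^{-2} V ≤ e^{-2} V`
    nlinarith [mul_pos hm2 hV95]
  · -- (T3a) `e^{-4} V ≤ 0.99 e^{-2} V` ⟸ `e^{-2} ≤ 0.99`
    have h : Real.exp (-2) ≤ 99 / 100 := by nlinarith
    calc Real.exp (-4) * (95 * Real.pi ^ 2)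
        = Real.exp (-2) * (Real.exp (-2) * (95 * Real.pi ^ 2)) := by rw [Em4]; ring
      _ ≤ 99 / 100 * (Real.exp (-2) * (95 * Real.pi ^ 2)) :=
          mul_le_mul_of_nonneg_right h (by positivity)
  · -- (T3b) `0.99 e^{-2} V ≤ e^{-1} V` ⟸ `e^{-2} ≤ e^{-1}`
    have h : Real.exp (-2) ≤ Real.exp (-1) := Real.exp_le_exp.mpr (by norm_num)
    calc 99 / 100 * (Real.exp (-2) * (95 * Real.pi ^ 2))
        ≤ Real.exp (-2) * (95 * Real.pi ^ 2) := by nlinarith [mul_pos hm2 hV95]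
      _ ≤ Real.exp (-1) * (95 * Real.pi ^ 2) := mul_le_mul_of_nonneg_right h hV95.le
  · -- (T5) `100π² ≤ ½ (e⁴ · 0.99 e^{-2} · 95π² − 95π²) = 47.5π² (0.99 e² − 1)`
    have key : 1 / 2 * (Real.exp 4 * (99 / 100 * (Real.exp (-2) * (95 * Real.pi ^ 2))) - 95 * Real.pi ^ 2)
        = 95 / 2 * Real.pi ^ 2 * (99 / 100 * (Real.exp 4 * Real.exp (-2)) - 1) := by ring
    rw [key, E42]
    nlinarith
  · -- (T6) `100π² ≤ ½ · 95π² · (e³ − 1)`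
    rw [show (4 : ℝ) - 1 = 3 by norm_num]
    nlinarith
  · -- (T7) `2·95π² − 192π² ≤ 100π²`
    nlinarith
  · -- (T8) `18·95π² − 1536π² < 1500π²`
    nlinarith
  · -- (T9) `100π² ≤ 95π² · 2 · (3/2)`
    nlinarith
  · -- violation `94π² ≤ 100π²`
    nlinarith

/-- **The printed scalar toolkit does not imply the variance budget**: it is FALSE that for all reals
`V, Z, D, fmax, fmin, Rmin` the conjuncts (T1)–(T10) imply `D < 2V − 96π²` (STUB 1's inequality,
`stub_varianceBudget` of `Lines/cgy-variance-pivot.lean`). Hence STUB 1 is not a consequence of the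
density floor, Jensen, the Cheng–Ribeiro–Zhou bounds (coarea, Thm. 1, Thm. 2), Chern–Gauss–Bonnet /
Gursky, Catino's pinching and the Bhatia–Davis bound by real arithmetic; some non-scalar input or a new
sup-type bound must enter. [cite: ChengRibeiroZhou2022, Thm. 1, Thm. 2 and §3.2] -/
theorem not_budget_of_scalarToolkit :
    ¬ (∀ V Z D fmax fmin Rmin : ℝ,
        -- (T1) density floor
        32 * Real.pi ^ 2 * Real.sqrt Real.pi * Real.exp (-(3 : ℝ) / 2) < Z →
        -- (T2) Jensen
        Z ≤ Real.exp (-2) * V →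
        -- (T3) sandwich
        (Real.exp (-fmax) * V ≤ Z ∧ Z ≤ Real.exp (-fmin) * V) →
        -- (T4) window
        (0 < Rmin ∧ Rmin ≤ fmin ∧ fmin < 2 ∧ 2 < fmax) →
        -- (T5) CRZ coarea bound
        D ≤ 1 / 2 * (Real.exp fmax * Z - V) →
        -- (T6) CRZ Thm. 1 at χ = 2
        D ≤ 1 / 2 * V * (Real.exp (fmax - fmin) - 1) →
        -- (T7) CRZ Thm. 2 / Gursky / CGB + ∫|W|² ≥ 0
        2 * V - 192 * Real.pi ^ 2 ≤ D →
        -- (T8) Catino pinching, non-round branch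
        18 * V - 1536 * Real.pi ^ 2 < 15 * D →
        -- (T9) Bhatia–Davis
        D ≤ V * (fmax - 2) * (2 - Rmin) →
        -- (T10) signs
        (0 ≤ D ∧ 0 < V) →
        D < 2 * V - 96 * Real.pi ^ 2) := by
  intro h
  obtain ⟨h1, h2, h3, h4, h5, h6, h7, h8, h9, h10, hviol⟩ := scalarToolkit_witness
  have := h (95 * Real.pi ^ 2) (99 / 100 * (Real.exp (-2) * (95 * Real.pi ^ 2))) (100 * Real.pi ^ 2) 4 1 (1 / 2)
    h1 h2 h3 h4 h5 h6 h7 h8 h9 h10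
  exact absurd this (not_lt.mpr hviol)

/-- **Even the exact weighted identities cannot bound the variance without `sup f`** (distribution-level
sharpening of `not_budget_of_scalarToolkit`). For every `0 < m ≤ ¼` there is a three-atom volume
distribution — bulk atom `A` (fraction `a`, `f = 2`, `R = η ∈ (0,2]`), hot atom `B` (fraction `m`,
`f = R = 1/m`), cold atom `C` (fraction `s = (1 − 2m)e^{1−1/m} ≤ m`, `f = R = 1`) — satisfying the
pointwise coupling `0 < R ≤ f` (`R > 0`, `R + |∇f|² = f`), the unweighted mean `∫R dV = 2V`, the EXACT
weighted identity `∫(f − 2)e^{-f} dV = 0` (`Δ_f f = 2 − f` integrated), Jensen `∫e^{-f} ≤ e^{-2}V`, and the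
density floor up to slack `2m` (`∫e^{-f} dV ≥ (1 − 2m)e^{-2}V`, i.e. admissible for the crux as soon as
`V ≥ 93.6π²/(1 − 2m)`), whose variance `D/V = Σ mass·(R − 2)² ≥ 1/(4m)` is UNBOUNDED as `m → 0`. So the
`dV`-distribution of `f` being pinned near `2` by the density (it is: `Vol{f ≥ 3} < 6 %` at `V = 95π²`)
does not pin the distribution of `R ≤ f`: all of `∫R dV = 2V` can be carried by a vanishing volume
fraction at `R = f = 1/m`, the bulk being Gaussian-like (`f ≈ 2`, `R ≈ η`). Any proof of STUB 1 must
therefore use structure beyond {scalar toolkit, weighted identities in `f`, `0 < R ≤ f`} — e.g. a sup bound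
`f_max ≤ 3.08`, or genuinely tensorial/PDE input. [folklore] -/
theorem weightedIdentities_cannot_bound_variance {m : ℝ} (hm : 0 < m) (hm4 : m ≤ 1 / 4) :
    ∃ a b c fA fB fC RA RB RC : ℝ,
      (0 < a ∧ 0 < b ∧ 0 < c ∧ a + b + c = 1) ∧
      ((0 < RA ∧ RA ≤ fA) ∧ (0 < RB ∧ RB ≤ fB) ∧ (0 < RC ∧ RC ≤ fC)) ∧
      a * RA + b * RB + c * RC = 2 ∧
      a * ((fA - 2) * Real.exp (-fA)) + b * ((fB - 2) * Real.exp (-fB)) +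
          c * ((fC - 2) * Real.exp (-fC)) = 0 ∧
      (1 - 2 * m) * Real.exp (-2) ≤ a * Real.exp (-fA) + b * Real.exp (-fB) + c * Real.exp (-fC) ∧
      a * Real.exp (-fA) + b * Real.exp (-fB) + c * Real.exp (-fC) ≤ Real.exp (-2) ∧
      1 / (4 * m) ≤ a * (RA - 2) ^ 2 + b * (RB - 2) ^ 2 + c * (RC - 2) ^ 2 := by
  -- the three atoms: bulk A (f = 2, R = η), hot B (f = R = 1/m, mass m), cold C (f = R = 1, mass s)
  set s : ℝ := (1 - 2 * m) * Real.exp (1 - 1 / m) with hs_def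
  have h12 : 0 < 1 - 2 * m := by linarith
  have hs_pos : 0 < s := mul_pos h12 (Real.exp_pos _)
  -- `e^{1 - 1/m} ≤ m` (from `1 - 1/x ≤ log x`)
  have hexp_le : Real.exp (1 - 1 / m) ≤ m := by
    have h := Real.one_sub_inv_le_log_of_pos hm
    calc Real.exp (1 - 1 / m) ≤ Real.exp (Real.log m) := Real.exp_le_exp.mpr (by simpa [one_div] using h)
      _ = m := Real.exp_log hm
  have hs_le : s ≤ m := by
    calc s = (1 - 2 * m) * Real.exp (1 - 1 / m) := hs_def
      _ ≤ 1 * Real.exp (1 - 1 / m) := by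
          apply mul_le_mul_of_nonneg_right _ (Real.exp_pos _).le; linarith
      _ ≤ m := by rw [one_mul]; exact hexp_le
  set a : ℝ := 1 - m - s with ha_def
  have ha_pos : 0 < a := by simp only [ha_def]; linarith
  set η : ℝ := (1 - s) / a with hη_def
  have hη_pos : 0 < η := div_pos (by linarith) ha_pos
  have haη : a * η = 1 - s := by
    simp only [hη_def]; field_simp
  have hη_le : η ≤ 2 := by
    rw [hη_def, div_le_iff₀ ha_pos, ha_def]; linarith
  have hmF : m * (1 / m) = 1 := by field_simp
  have hF_pos : 0 < 1 / m := by positivity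
  -- exponent bookkeeping
  have hE : Real.exp (1 - 1 / m) * Real.exp (-1) = Real.exp (-(1 / m)) := by
    rw [← Real.exp_add]; ring_nf
  refine ⟨a, m, s, 2, 1 / m, 1, η, 1 / m, 1, ⟨ha_pos, hm, hs_pos, by simp only [ha_def]; ring⟩,
    ⟨⟨hη_pos, hη_le⟩, ⟨hF_pos, le_rfl⟩, ⟨one_pos, le_rfl⟩⟩, ?_, ?_, ?_, ?_, ?_⟩
  · -- (i) `aη + m·(1/m) + s = (1 − s) + 1 + s = 2`
    rw [haη, hmF]; ring
  · -- (ii) `0 + (1 − 2m)e^{-1/m} − s e^{-1} = 0`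
    have h1 : m * ((1 / m - 2) * Real.exp (-(1 / m))) = (1 - 2 * m) * Real.exp (-(1 / m)) := by
      have : m * (1 / m - 2) = 1 - 2 * m := by field_simp
      rw [← mul_assoc, this]
    rw [h1, hs_def]
    have : (1 - 2 * m) * Real.exp (1 - 1 / m) * (((1 : ℝ) - 2) * Real.exp (-1))
        = -((1 - 2 * m) * (Real.exp (1 - 1 / m) * Real.exp (-1))) := by ring
    rw [this, hE]
    simp
  · -- (iii) `Z/V ≥ a e^{-2} ≥ (1 − 2m) e^{-2}`
    have h1 : (1 - 2 * m) * Real.exp (-2) ≤ a * Real.exp (-2) := by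
      apply mul_le_mul_of_nonneg_right _ (Real.exp_pos _).le
      simp only [ha_def]; linarith
    have h2 : 0 ≤ m * Real.exp (-(1 / m)) := by positivity
    have h3 : 0 ≤ s * Real.exp (-1) := by positivity
    linarith
  · -- Jensen `Z/V ≤ e^{-2}`: `m e^{-1/m} + s e^{-1} = (1 − m) e^{-1/m} ≤ m e^{-2} ≤ (m + s) e^{-2}`
    have hsE : s * Real.exp (-1) = (1 - 2 * m) * Real.exp (-(1 / m)) := by
      rw [hs_def, mul_assoc, hE]
    -- `(1 − m) e^{-1/m} ≤ m e^{-2}` ⟸ `(1/m − 1) ≤ e^{1/m − 2}`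
    have hx : 1 / m - 2 + 1 ≤ Real.exp (1 / m - 2) := Real.add_one_le_exp _
    have hkey : (1 - m) * Real.exp (-(1 / m)) ≤ m * Real.exp (-2) := by
      have hE2 : Real.exp (1 / m - 2) * Real.exp (-(1 / m)) = Real.exp (-2) := by
        rw [← Real.exp_add]; ring_nf
      have h1 : (1 - m) = m * (1 / m - 2 + 1) := by field_simp; ring
      calc (1 - m) * Real.exp (-(1 / m)) = m * (1 / m - 2 + 1) * Real.exp (-(1 / m)) := by rw [← h1]
        _ ≤ m * Real.exp (1 / m - 2) * Real.exp (-(1 / m)) := by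
            apply mul_le_mul_of_nonneg_right _ (Real.exp_pos _).le
            exact mul_le_mul_of_nonneg_left hx hm.le
        _ = m * Real.exp (-2) := by rw [mul_assoc, hE2]
    have hsm : m * Real.exp (-2) ≤ (m + s) * Real.exp (-2) :=
      mul_le_mul_of_nonneg_right (by linarith) (Real.exp_pos _).le
    have hsum : a * Real.exp (-2) + m * Real.exp (-(1 / m)) + s * Real.exp (-1)
        = a * Real.exp (-2) + (1 - m) * Real.exp (-(1 / m)) := by rw [hsE]; ring
    rw [hsum]
    have ha1 : a + (m + s) = 1 := by simp only [ha_def]; ring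
    nlinarith [Real.exp_pos (-2 : ℝ)]
  · -- variance `≥ m (1/m − 2)² = (1 − 2m)²/m ≥ 1/(4m)`
    have h1 : m * (1 / m - 2) ^ 2 = (1 - 2 * m) ^ 2 / m := by field_simp
    have h2 : 1 / (4 * m) ≤ (1 - 2 * m) ^ 2 / m := by
      rw [div_le_div_iff₀ (by positivity) hm]
      nlinarith
    have h3 : 0 ≤ a * (η - 2) ^ 2 := by positivity
    have h4 : 0 ≤ s * ((1 : ℝ) - 2) ^ 2 := by positivity
    linarith [h1]


/-! ## §15 (v8) Density pinning: where the volume of a counterexample sits -/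

/-- tangent-line deficit `ψ(t) = e^{-2} − (t − 1)e^{-t} ≥ 0`, increasing on `[2, ∞)`, decreasing on `(-∞, 2]`. -/
theorem psi_mono_of_two_le {T t : ℝ} (hT : 2 ≤ T) (ht : T ≤ t) :
    (t - 1) * Real.exp (-t) ≤ (T - 1) * Real.exp (-T) := by
  -- (t-1)e^{-t} = (T-1 + (t-T)) e^{-T} e^{-(t-T)} ≤ (T-1) e^{-T} iff (T - 1 + u) e^{-u} ≤ T - 1 for u = t - T ≥ 0
  have hu : 0 ≤ t - T := by linarith
  have hE : Real.exp (-t) = Real.exp (-T) * Real.exp (-(t - T)) := by rw [← Real.exp_add]; ring_nf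
  rw [hE]
  have h1 : (T - 1 + (t - T)) * Real.exp (-(t - T)) ≤ T - 1 := by
    -- e^{u} ≥ 1 + u ≥ (T-1+u)/(T-1) when T - 1 ≥ 1
    have hexp : t - T + 1 ≤ Real.exp (t - T) := Real.add_one_le_exp _
    have hpos : 0 < Real.exp (t - T) := Real.exp_pos _
    have hinv : Real.exp (-(t - T)) * Real.exp (t - T) = 1 := by rw [← Real.exp_add]; simp
    have key : (T - 1 + (t - T)) ≤ (T - 1) * Real.exp (t - T) := by nlinarith
    calc (T - 1 + (t - T)) * Real.exp (-(t - T))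
        ≤ (T - 1) * Real.exp (t - T) * Real.exp (-(t - T)) :=
          mul_le_mul_of_nonneg_right key (Real.exp_pos _).le
      _ = T - 1 := by rw [mul_assoc, mul_comm (Real.exp (t - T)), hinv, mul_one]
  calc (t - 1) * (Real.exp (-T) * Real.exp (-(t - T)))
      = Real.exp (-T) * ((T - 1 + (t - T)) * Real.exp (-(t - T))) := by ring
    _ ≤ Real.exp (-T) * (T - 1) := mul_le_mul_of_nonneg_left h1 (Real.exp_pos _).le
    _ = (T - 1) * Real.exp (-T) := by ring

theorem psi_mono_of_le_two {T t : ℝ} (hT : T ≤ 2) (ht : t ≤ T) :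
    (t - 1) * Real.exp (-t) ≤ (T - 1) * Real.exp (-T) := by
  -- with u = T - t ≥ 0: (t-1)e^{-t} = (T-1-u)e^{-T}e^{u}; need (T-1-u)e^{u} ≤ T-1, i.e. since T - 1 ≤ 1:
  have hu : 0 ≤ T - t := by linarith
  have hE : Real.exp (-t) = Real.exp (-T) * Real.exp (T - t) := by rw [← Real.exp_add]; ring_nf
  rw [hE]
  have h1 : (T - 1 - (T - t)) * Real.exp (T - t) ≤ T - 1 := by
    by_cases hneg : T - 1 - (T - t) ≤ 0
    · have : (T - 1 - (T - t)) * Real.exp (T - t) ≤ 0 :=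
        mul_nonpos_of_nonpos_of_nonneg hneg (Real.exp_pos _).le
      -- and T - 1 ≥ t - 1 > ... need T - 1 ≥ 0? not nec.; but (t-1) ≤ 0 case: T - 1 ≥ t - 1; if T - 1 < 0 then
      -- we need LHS ≤ T - 1 < 0: LHS = (t-1) e^{T-t} ≤ (t - 1) ≤ T - 1 since t - 1 ≤ 0 and e^{T-t} ≥ 1
      have ht1 : t - 1 ≤ 0 := by linarith
      have hge : 1 ≤ Real.exp (T - t) := Real.one_le_exp hu
      have : (t - 1) * Real.exp (T - t) ≤ (t - 1) * 1 := mul_le_mul_of_nonpos_left hge ht1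
      have h' : T - 1 - (T - t) = t - 1 := by ring
      rw [h']; linarith
    · push Not at hneg
      -- 0 < t - 1 ≤ T - 1 ≤ 1; e^{u} ≤ 1/(1-u) for u < 1: (t-1) e^{T-t} ≤ T - 1 ⟸ e^{u}(T-1-u) ≤ T-1
      -- use e^{-u} ≥ 1 - u ⇒ e^{u} (1 - u) ≤ 1, and (T-1-u) ≤ (T-1)(1-u) iff u(T-1) ≤ u iff T - 1 ≤ 1 ✓
      have hexp : 1 - (T - t) ≤ Real.exp (-(T - t)) := by
        have := Real.add_one_le_exp (-(T - t)); linarith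
      have hinv : Real.exp (-(T - t)) * Real.exp (T - t) = 1 := by rw [← Real.exp_add]; simp
      have hT1 : T - 1 ≤ 1 := by linarith
      have ht1 : 0 < t - 1 := by have h' : T - 1 - (T - t) = t - 1 := by ring
                                 linarith [h' ▸ hneg]
      have hstep : T - 1 - (T - t) ≤ (T - 1) * (1 - (T - t)) := by nlinarith
      calc (T - 1 - (T - t)) * Real.exp (T - t)
          ≤ (T - 1) * (1 - (T - t)) * Real.exp (T - t) :=
            mul_le_mul_of_nonneg_right hstep (Real.exp_pos _).le
        _ ≤ (T - 1) * Real.exp (-(T - t)) * Real.exp (T - t) := by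
            apply mul_le_mul_of_nonneg_right _ (Real.exp_pos _).le
            exact mul_le_mul_of_nonneg_left hexp (by linarith)
        _ = T - 1 := by rw [mul_assoc, hinv, mul_one]
  calc (t - 1) * (Real.exp (-T) * Real.exp (T - t))
      = Real.exp (-T) * ((T - 1 - (T - t)) * Real.exp (T - t)) := by ring
    _ ≤ Real.exp (-T) * (T - 1) := mul_le_mul_of_nonneg_left h1 (Real.exp_pos _).le
    _ = (T - 1) * Real.exp (-T) := by ring

/-- **Density pinning of the `dV`-law of `f`** (measure-theoretic core). -/
theorem volume_superlevel_le {α : Type*} [MeasurableSpace α] (μ : Measure α) [IsFiniteMeasure μ]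
    (f : α → ℝ) (hfm : Measurable f)
    (h₁ : Integrable (fun x ↦ Real.exp (-f x)) μ)
    (h₂ : Integrable (fun x ↦ f x * Real.exp (-f x)) μ)
    (hid : ∫ x, f x * Real.exp (-f x) ∂μ = 2 * ∫ x, Real.exp (-f x) ∂μ)
    {ε : ℝ} (hdens : (1 - ε) * (Real.exp (-2) * (μ univ).toReal) ≤ ∫ x, Real.exp (-f x) ∂μ)
    {T : ℝ} (hT : 2 ≤ T) :
    (1 - (T - 1) * Real.exp (2 - T)) * (μ {x | T ≤ f x}).toReal ≤ ε * (μ univ).toReal := by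
  -- ψ(f) := e^{-2} − (f − 1)e^{-f} ≥ 0 has ∫ψ(f) = e^{-2}μ − ∫e^{-f} ≤ ε e^{-2} μ, and ψ(f) ≥ ψ(T) on {f ≥ T}.
  set S := {x | T ≤ f x} with hS
  have hSm : MeasurableSet S := hfm measurableSet_Ici
  have hψ_nonneg : ∀ t : ℝ, 0 ≤ Real.exp (-2) - (t - 1) * Real.exp (-t) := by
    intro t
    have h1 : t - 2 + 1 ≤ Real.exp (t - 2) := Real.add_one_le_exp (t - 2)
    have h2 : 0 < Real.exp (-t) := Real.exp_pos _
    have : (t - 1) * Real.exp (-t) ≤ Real.exp (-2) := by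
      calc (t - 1) * Real.exp (-t) ≤ Real.exp (t - 2) * Real.exp (-t) := by
            apply mul_le_mul_of_nonneg_right _ h2.le; linarith
        _ = Real.exp (-2) := by rw [← Real.exp_add]; ring_nf
    linarith
  have hψT : ∀ x ∈ S, Real.exp (-2) - (T - 1) * Real.exp (-T) ≤ Real.exp (-2) - (f x - 1) * Real.exp (-f x) := by
    intro x hx
    have := psi_mono_of_two_le hT hx
    linarith
  -- integrability of ψ ∘ f
  have hψint : Integrable (fun x ↦ Real.exp (-2) - (f x - 1) * Real.exp (-f x)) μ := by
    have : (fun x ↦ Real.exp (-2) - (f x - 1) * Real.exp (-f x))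
        = fun x ↦ Real.exp (-2) - (f x * Real.exp (-f x) - Real.exp (-f x)) := by
      funext x; ring
    rw [this]
    have hI : Integrable (fun x ↦ f x * Real.exp (-f x) - Real.exp (-f x)) μ := h₂.sub h₁
    exact (integrable_const _).sub hI
  -- ∫ ψ(f) = e^{-2} μ(univ) - ∫ e^{-f}
  have hψval : ∫ x, (Real.exp (-2) - (f x - 1) * Real.exp (-f x)) ∂μ
      = Real.exp (-2) * (μ univ).toReal - ∫ x, Real.exp (-f x) ∂μ := by
    have : (fun x ↦ Real.exp (-2) - (f x - 1) * Real.exp (-f x))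
        = fun x ↦ Real.exp (-2) - (f x * Real.exp (-f x) - Real.exp (-f x)) := by
      funext x; ring
    have hI : Integrable (fun x ↦ f x * Real.exp (-f x) - Real.exp (-f x)) μ := h₂.sub h₁
    rw [this, integral_sub (integrable_const _) hI, integral_sub h₂ h₁, integral_const, hid,
      smul_eq_mul, Measure.real]
    ring
  -- lower bound: ∫ ψ(f) ≥ ∫_S ψ(f) ≥ ψ(T) μ(S)
  have hlow : (Real.exp (-2) - (T - 1) * Real.exp (-T)) * (μ S).toReal
      ≤ ∫ x, (Real.exp (-2) - (f x - 1) * Real.exp (-f x)) ∂μ := by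
    calc (Real.exp (-2) - (T - 1) * Real.exp (-T)) * (μ S).toReal
        = ∫ x in S, (Real.exp (-2) - (T - 1) * Real.exp (-T)) ∂μ := by
          rw [setIntegral_const, smul_eq_mul, Measure.real]; ring
      _ ≤ ∫ x in S, (Real.exp (-2) - (f x - 1) * Real.exp (-f x)) ∂μ := by
          apply setIntegral_mono_on (integrable_const _).integrableOn hψint.integrableOn hSm
          intro x hx; exact hψT x hx
      _ ≤ ∫ x, (Real.exp (-2) - (f x - 1) * Real.exp (-f x)) ∂μ :=
          setIntegral_le_integral hψint (ae_of_all _ fun x ↦ hψ_nonneg (f x))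
  -- combine: ψ(T) μ(S) ≤ e^{-2}μ − ∫e^{-f} ≤ ε e^{-2} μ ; divide by e^{-2}: (1 − (T−1)e^{2−T}) μ(S) ≤ ε μ
  have hE : Real.exp (-T) = Real.exp (-2) * Real.exp (2 - T) := by rw [← Real.exp_add]; ring_nf
  have hfac : Real.exp (-2) - (T - 1) * Real.exp (-T) = Real.exp (-2) * (1 - (T - 1) * Real.exp (2 - T)) := by
    rw [hE]; ring
  have h2pos : 0 < Real.exp (-2) := Real.exp_pos _
  have hchain : Real.exp (-2) * ((1 - (T - 1) * Real.exp (2 - T)) * (μ S).toReal)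
      ≤ Real.exp (-2) * (ε * (μ univ).toReal) := by
    have := hlow
    rw [hfac, hψval] at this
    nlinarith
  exact le_of_mul_le_mul_left hchain h2pos

/-- **Density pinning, sublevel side** (measure-theoretic core). -/
theorem volume_sublevel_le {α : Type*} [MeasurableSpace α] (μ : Measure α) [IsFiniteMeasure μ]
    (f : α → ℝ) (hfm : Measurable f)
    (h₁ : Integrable (fun x ↦ Real.exp (-f x)) μ)
    (h₂ : Integrable (fun x ↦ f x * Real.exp (-f x)) μ)
    (hid : ∫ x, f x * Real.exp (-f x) ∂μ = 2 * ∫ x, Real.exp (-f x) ∂μ)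
    {ε : ℝ} (hdens : (1 - ε) * (Real.exp (-2) * (μ univ).toReal) ≤ ∫ x, Real.exp (-f x) ∂μ)
    {T : ℝ} (hT : T ≤ 2) :
    (1 - (T - 1) * Real.exp (2 - T)) * (μ {x | f x ≤ T}).toReal ≤ ε * (μ univ).toReal := by
  -- ψ(f) := e^{-2} − (f − 1)e^{-f} ≥ 0 has ∫ψ(f) = e^{-2}μ − ∫e^{-f} ≤ ε e^{-2} μ, and ψ(f) ≥ ψ(T) on {f ≥ T}.
  set S := {x | f x ≤ T} with hS
  have hSm : MeasurableSet S := hfm measurableSet_Iic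
  have hψ_nonneg : ∀ t : ℝ, 0 ≤ Real.exp (-2) - (t - 1) * Real.exp (-t) := by
    intro t
    have h1 : t - 2 + 1 ≤ Real.exp (t - 2) := Real.add_one_le_exp (t - 2)
    have h2 : 0 < Real.exp (-t) := Real.exp_pos _
    have : (t - 1) * Real.exp (-t) ≤ Real.exp (-2) := by
      calc (t - 1) * Real.exp (-t) ≤ Real.exp (t - 2) * Real.exp (-t) := by
            apply mul_le_mul_of_nonneg_right _ h2.le; linarith
        _ = Real.exp (-2) := by rw [← Real.exp_add]; ring_nf
    linarith
  have hψT : ∀ x ∈ S, Real.exp (-2) - (T - 1) * Real.exp (-T) ≤ Real.exp (-2) - (f x - 1) * Real.exp (-f x) := by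
    intro x hx
    have := psi_mono_of_le_two hT hx
    linarith
  -- integrability of ψ ∘ f
  have hψint : Integrable (fun x ↦ Real.exp (-2) - (f x - 1) * Real.exp (-f x)) μ := by
    have : (fun x ↦ Real.exp (-2) - (f x - 1) * Real.exp (-f x))
        = fun x ↦ Real.exp (-2) - (f x * Real.exp (-f x) - Real.exp (-f x)) := by
      funext x; ring
    rw [this]
    have hI : Integrable (fun x ↦ f x * Real.exp (-f x) - Real.exp (-f x)) μ := h₂.sub h₁
    exact (integrable_const _).sub hI
  -- ∫ ψ(f) = e^{-2} μ(univ) - ∫ e^{-f}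
  have hψval : ∫ x, (Real.exp (-2) - (f x - 1) * Real.exp (-f x)) ∂μ
      = Real.exp (-2) * (μ univ).toReal - ∫ x, Real.exp (-f x) ∂μ := by
    have : (fun x ↦ Real.exp (-2) - (f x - 1) * Real.exp (-f x))
        = fun x ↦ Real.exp (-2) - (f x * Real.exp (-f x) - Real.exp (-f x)) := by
      funext x; ring
    have hI : Integrable (fun x ↦ f x * Real.exp (-f x) - Real.exp (-f x)) μ := h₂.sub h₁
    rw [this, integral_sub (integrable_const _) hI, integral_sub h₂ h₁, integral_const, hid,
      smul_eq_mul, Measure.real]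
    ring
  -- lower bound: ∫ ψ(f) ≥ ∫_S ψ(f) ≥ ψ(T) μ(S)
  have hlow : (Real.exp (-2) - (T - 1) * Real.exp (-T)) * (μ S).toReal
      ≤ ∫ x, (Real.exp (-2) - (f x - 1) * Real.exp (-f x)) ∂μ := by
    calc (Real.exp (-2) - (T - 1) * Real.exp (-T)) * (μ S).toReal
        = ∫ x in S, (Real.exp (-2) - (T - 1) * Real.exp (-T)) ∂μ := by
          rw [setIntegral_const, smul_eq_mul, Measure.real]; ring
      _ ≤ ∫ x in S, (Real.exp (-2) - (f x - 1) * Real.exp (-f x)) ∂μ := by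
          apply setIntegral_mono_on (integrable_const _).integrableOn hψint.integrableOn hSm
          intro x hx; exact hψT x hx
      _ ≤ ∫ x, (Real.exp (-2) - (f x - 1) * Real.exp (-f x)) ∂μ :=
          setIntegral_le_integral hψint (ae_of_all _ fun x ↦ hψ_nonneg (f x))
  -- combine: ψ(T) μ(S) ≤ e^{-2}μ − ∫e^{-f} ≤ ε e^{-2} μ ; divide by e^{-2}: (1 − (T−1)e^{2−T}) μ(S) ≤ ε μ
  have hE : Real.exp (-T) = Real.exp (-2) * Real.exp (2 - T) := by rw [← Real.exp_add]; ring_nf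
  have hfac : Real.exp (-2) - (T - 1) * Real.exp (-T) = Real.exp (-2) * (1 - (T - 1) * Real.exp (2 - T)) := by
    rw [hE]; ring
  have h2pos : 0 < Real.exp (-2) := Real.exp_pos _
  have hchain : Real.exp (-2) * ((1 - (T - 1) * Real.exp (2 - T)) * (μ S).toReal)
      ≤ Real.exp (-2) * (ε * (μ univ).toReal) := by
    have := hlow
    rw [hfac, hψval] at this
    nlinarith
  exact le_of_mul_le_mul_left hchain h2pos


/-- **Pinning constants** `1 − (T−1)e^{2−T}`: `> .264` at `T = 3`, `> .593` at `T = 4`, `> .175` at `t = 3/2`, `= 1` at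
`t = 1`. With `ε = 1 − e²Z₀/V` (`= .0157` at `V = 95π²`, `< .065` for `V ≤ 100π²`) the pinning lemmas give
`Vol{f ≥ 3} ≤ ε V/.264`, `Vol{f ≥ 4} ≤ εV/.593`, `Vol{f ≤ 3/2} ≤ εV/.175`, `Vol{f ≤ 1} ≤ εV`: at `V = 95π²` these are
`5.9 %`, `2.6 %`, `8.9 %`, `1.6 %` of the volume. [folklore] -/
theorem pinning_constants :
    (0.264 : ℝ) < 1 - (3 - 1) * Real.exp (2 - 3) ∧ (0.593 : ℝ) < 1 - (4 - 1) * Real.exp (2 - 4) ∧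
    (0.175 : ℝ) < 1 - (3 / 2 - 1) * Real.exp (2 - 3 / 2) ∧ (1 : ℝ) = 1 - (1 - 1) * Real.exp (2 - 1) := by
  have he1 : 2.7182818283 < Real.exp 1 := Real.exp_one_gt_d9
  have hE1 : Real.exp (-1) * Real.exp 1 = 1 := by rw [← Real.exp_add]; norm_num
  have hE2 : Real.exp (-2) * (Real.exp 1 * Real.exp 1) = 1 := by rw [← Real.exp_add, ← Real.exp_add]; norm_num
  have hm1 : Real.exp (-1) < 0.368 := by nlinarith [Real.exp_pos (-1 : ℝ)]
  have hm2 : Real.exp (-2) < 0.1354 := by nlinarith [Real.exp_pos (-2 : ℝ), Real.exp_pos (1 : ℝ)]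
  have hh : Real.exp (1 / 2) < 1.6488 := by
    have h2 : Real.exp (1 / 2) ^ 2 < (1.6488 : ℝ) ^ 2 := by
      rw [← Real.exp_nat_mul]; norm_num
      have := Real.exp_one_lt_d9; linarith
    exact lt_of_pow_lt_pow_left₀ 2 (by norm_num) h2
  refine ⟨?_, ?_, ?_, ?_⟩
  · rw [show (2 : ℝ) - 3 = -1 by norm_num]; linarith
  · rw [show (2 : ℝ) - 4 = -2 by norm_num]; linarith
  · rw [show (2 : ℝ) - 3 / 2 = 1 / 2 by norm_num]; linarith
  · norm_num

/-- **The Jensen-scale slack** `ε = 1 − e²Z₀/V` at `V = 95π²` is below `1.6 %` (`e²Z₀ = 32π²√π e^{1/2} > 93.5π²`),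
and below `6.5 %` for every `V ≤ 100π²`. [folklore] -/
theorem pinning_slack :
    1 - 32 * Real.pi ^ 2 * Real.sqrt Real.pi * Real.exp (1 / 2) / (95 * Real.pi ^ 2) < 0.016 ∧
    1 - 32 * Real.pi ^ 2 * Real.sqrt Real.pi * Real.exp (1 / 2) / (100 * Real.pi ^ 2) < 0.065 := by
  have hπ := Real.pi_pos
  have hp2 : 0 < Real.pi ^ 2 := by positivity
  have hs : (1.77245 : ℝ) < Real.sqrt Real.pi := by
    rw [Real.lt_sqrt (by norm_num)]
    have := Real.pi_gt_d6; nlinarith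
  have ht : (1.6487 : ℝ) < Real.exp (1 / 2) := by
    have h : (1.6487 : ℝ) ^ 2 < Real.exp (1 / 2) ^ 2 := by
      rw [← Real.exp_nat_mul]; norm_num
      have := Real.exp_one_gt_d9; linarith
    exact lt_of_pow_lt_pow_left₀ 2 (Real.exp_pos _).le h
  have key : (2.9222 : ℝ) < Real.sqrt Real.pi * Real.exp (1 / 2) := by nlinarith
  have h1 : 32 * Real.pi ^ 2 * Real.sqrt Real.pi * Real.exp (1 / 2) / (95 * Real.pi ^ 2)
      = 32 * (Real.sqrt Real.pi * Real.exp (1 / 2)) / 95 := by field_simp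
  have h2 : 32 * Real.pi ^ 2 * Real.sqrt Real.pi * Real.exp (1 / 2) / (100 * Real.pi ^ 2)
      = 32 * (Real.sqrt Real.pi * Real.exp (1 / 2)) / 100 := by field_simp
  rw [h1, h2]
  constructor <;> nlinarith

/-! ## §16 (v8) Two more "why no counterexample by analogy" checks (PAPER / computed this cycle)

* DENSITY TABLE IN ALL DIMENSIONS (closed formulas `Θ(Sⁿ) = ω_n((n−1)/(2πe))^{n/2}`, `Θ(S^{n−1}×ℝ) = Θ(S^{n−1})`,
  `Θ(ℂP^m) = ((m+1)/e)^m/m!`, `Θ(S^p×S^q) = Θ(S^p)Θ(S^q)`; folder `NOTES.md §dimtable`): for every `3 ≤ n ≤ 30` the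
  cylinder is the densest classical non-spherical shrinker and `Θ(ℂP^{n/2})`, `Θ(S^p×S^q)` are far below it
  (`n = 4`: `.812 > .791 > .609 > .541`; `n = 6`: `.830 > .823 > .626 (S³×S³) > .531 (ℂP³)`); the window
  `1 − Θ_cyl/Θ_sph` is `6.98 % (n=3), 2.59 % (4), 1.34 % (5), .81 % (6), .55 % (7) … .05 % (20)`. So the shape
  "density above the cylinder ⇒ sphere" is not a low-dimensional accident of the tables, but its margin is thinnest
  in high dimensions; in the Einstein sub-case it is Bishop–Cheeger–Colding volume almost-rigidity (`V̂ > Θ_cyl/Θ_sph`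
  `⇒` GH-close to round `⇒` diffeomorphic, non-effective `ε(n)`), consistent with drefute-g3's Böhm `S⁵` probe.
* MCF DICTIONARY ON THE SIDE OF EXAMPLES: the Ricci density `Θ = e^{ν}` corresponds to `1/λ` (Colding–Minicozzi
  entropy); CIMW 2013: `Sⁿ` has the LEAST entropy among closed shrinkers (⟷ `S⁴` densest compact), Bernstein–Wang:
  `λ ≤ λ(S^{n−1}×ℝ) ⇒ ≅ Sⁿ` (⟷ the crux/rung). Every non-round compact self-shrinker actually known — Angenent's torus
  (`λ ≈ 1.85 > λ(S¹×ℝ) = 1.52 > λ(S²) = 1.47`), Chopp's 1994 numerical shrinkers, Drugan's immersed `S²`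
  (arXiv:1304.0032), the Kapouleas–Kleene–Møller / Nguyen desingularisations, Drugan–Kleene rotational immersed
  examples — lies ABOVE the cylinder's entropy, i.e. is SPARSE in Ricci terms; and Brendle (arXiv:1411.4640): an
  EMBEDDED genus-0 shrinker in `ℝ³` is round. So the analogy that produced the route also predicts that exotic compact
  4-d Ricci shrinkers, should they exist at all (cohomogeneity ≥ 2, §8), sit at `Θ < Θ(S³×ℝ)` — on the safe side of
  the crux, exactly like Koiso–Cao (`.518`) and every orbifold of §11.
-/

/-! ## §17 (v9) LP cartography of budget violators in the `(V, f_max)` plane (numerics, this seat; folder `lp/`, kit j011012)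

SET-UP. Every quantity STUB 1 talks about is an integral of a function of `(f, R)` against `dV`; the joint volume
law `ν` of `(f, R)` on a crux datum satisfies the following LINEAR constraints (all exact consequences of the soliton
equations, identity (A) `dR = 2Ric(∇f,·)`, identity (B) `ΔR = ⟨∇R,∇f⟩ + R − 2|Ric|²`, `R + |∇f|² = f`, `R > 0`, and
integration by parts on the closed `M` — i.e. of the kind already LANDED as STUB 3 / STUB 7 — plus the density floor;
`E = (1/V)∫·dV`, `ε = 1 − e²Z₀/V`):
  (C1) `E1 = 1`; (C2) `E[R] = 2`; (C3) `E[(f−2)e^{-f}] = 0`; (C4) `E[e^{-f}] ≥ (1−ε)e^{-2}`; pointwise `0 < R ≤ f ≤ f_max`;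
  (W1) `E[(f − R)e^{-f}] = E[(f−2)²e^{-f}]`   (`∫|∇f|²e^{-f} = ∫(f−2)²e^{-f}`: `Δ_f f = 2 − f` tested against `f − 2`);
  (W2) `E[(R − R²/2)e^{-f}] ≥ 0`             (`∫(Δ_f R)e^{-f} = 0`, `Δ_f R = R − 2|Ric|²`, `|Ric|² ≥ R²/4`);
  (W2′) `E[(R − R²/2)e^{-f}] ≥ ½e^{-f_max}E[(R−2)²]`  (keep `2∫|E|²e^{-f} ≥ 2e^{-f_max}∫|E|² = e^{-f_max}D/2`);
  (U1) `E[(f − R)(3 − R)] = E[(R − 2)²]`       (`D = ∫|∇f|²(3 − R) dV`, drefute-g2's identity: (A) + `Δf = 2 − R` + IBP);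
  and two infinite families obtained by testing `Δ_f f = 2 − f` resp. `Δ_f R = R − 2|Ric|²` against functions of `f`:
  (Fφ) `E[φ′(f)(f − R)e^{-f}] = E[φ(f)(f − 2)e^{-f}]`, unweighted (η = e^{f}φ): `E[η(f)(2 − R)] = −E[η′(f)(f − R)]`
       (η = f gives the neat `E[fR] = 3E[f] − 2`);
  (Rφ) for `φ ≥ 0`: `E[(φ(f)(R − R²/2) + φ′(f)(f − R)(3 − f) + φ″(f)(f − R)²)e^{-f}] ≥ 0`
       (`∫φ(f)Δ_f R e^{-f} = −2∫φ′Ric(∇f,∇f)e^{-f}`, `Ric(∇f,∇f) = ½|∇f|² − ½⟨∇f,∇|∇f|²⟩`; `φ = e^{f}` returns U1 up to `∫|E|²`).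
  Two more valid families, not used below: the LSI/`W`-minimality of `f` among radial competitors `u² ∝ e^{-φ(f)}`,
  `E[(φ′²(f−R) + R + φ − 4)e^{-φ}] ≥ E[e^{-φ}]·log(E[e^{-f}]/E[e^{-φ}])` (equality at `φ = f`; Carrillo–Ni), and its second
  variation `E[(η′²(f−R) − 2ηη′(f−R) + η²(f − 5/2))e^{-f}] + (E[ηe^{-f}])²/(2E[e^{-f}]) ≥ 0`.
Maximising `E[(R−2)²] = D/V` over ALL laws on `{0 ≤ R ≤ f ≤ F}` subject to these constraints is a linear programme whose value
bounds `D/V` for every crux datum with `Vol = V`, `f_max ≤ F` (an OUTER relaxation: grid atoms, pure-python simplex here, HiGHS in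
the kit job). `F*(V) := sup{F : LPmax(V,F) < β(V) = 2 − 96π²/V}`; then (i) `f_max ≤ F*(V)` IMPLIES the budget at volume `V`, and
(ii) a VIOLATOR of volume `V` has `f_max = R_max > F*(V)`. (Numerics: grid `61 × 30` incl. `f = 2, 3` exactly; values ±0.05.)

RESULTS (variant C = C1–C4, W1, W2′, U1 + the CRZ coarea bound at `c = F`; `F*_CRZ` = CRZ + Jensen alone, `= 2 + log(5 − 192π²/V)`):
    V/π²     ε       β      F*_C     F*_CRZ        V/π²     ε       β      F*_C    F*_CRZ
     94    .0052   .979     ∞       3.084          117    .2007  1.180    3.80    3.212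
     95    .0157   .990     ∞       3.092          120    .2207  1.200    3.69    3.224
     96    .0259  1.000     ∞       3.099          124    .2459  1.226    3.64    3.239
     98    .0458  1.020   10.86     3.112          128    .2694  1.250    3.63    3.253   ← dip
    100    .0649  1.040    8.14     3.125          135    .3073  1.289    3.65    3.275
    104    .1008  1.077    5.47     3.149          150    .3766  1.360    3.70    3.314
    108    .1341  1.111    4.49     3.170          200    .5324  1.520    3.80    3.396
    110    .1499  1.127    4.26     3.180          500    .8130  1.808    3.96    3.530
    114    .1797  1.158    3.95     3.199         (stage C1–C6+U1 WITHOUT CRZ: dip ≈ 3.05 at V ≈ 120π²; hot/cold law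
                                                   with C1–C5 only: F*(95π²) = 19.5, F*(100π²) = 6.7, dip 2.59 at 117π²)
So: (a) at the Jensen scale `V ≤ 96π² = Vol(S⁴(√6))` NO sup bound below 12 is needed — the budget is automatic for `f_max ≤ 12`
(hot/cold relaxation: for `f_max ≤ 19` at `V = 95π²`); a violator with `V ≤ 100π²` needs `R_max = f_max > 8.1`, i.e. curvature
`> 4×` round somewhere, on `< 3 %` of its volume (§15); (b) the binding regime is `V ≈ 128π²`, where the combined threshold dips
to `inf_V F*_C(V) ≈ 3.63` — this REPLACES the CRZ sub-line's ceiling `c* = 3.0807` (`PotentialLeThree`) by `f ≤ 3.6` once W1, W2′, U1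
(M-sized identities with tree support) are added to `CRZSharpBound`; without CRZ at all (C1–C4, W1, W2, U1 only) the dip is
`≈ 3.05–3.10` (coarse) — numerically ABOVE 3 but too thin to recommend; (c) every violator has `V > 104π² > Vol(S⁴(√6))`,
`f_max = R_max > 3.6` and `dV`-RMS of `R − 2` above `1.04`: R-statistics as wild as the sparse orbifolds of §11 (`(3,2,1)`:
RMS `1.3`, `Θ ≤ .34`), versus Koiso–Cao's RMS `.30`. The maximising law at the dip (`V = 128π²`, `F = 3.63`) is a PEANUT: `47 %` of the volume at `f ≈ 2.1–2.2` with
`R ≈ 1.35` (the cylinder `S³(2)×ℝ` has `R ≡ 3/2`), `36 %` at `f ≈ 3.6` with `R ≈ 3.4–3.5` (caps rounder than `S⁴(√6)`), `11 %`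
at `f = R ≈ 1.2`, `6 %` Gaussian-far (`f ≈ 3.6`, `R ≈ 0`) — i.e. the statistics of a rotational ellipsoid/dumbbell, which is
exactly the object Kotschwar's theorem (SO(4)-invariant shrinkers on `S⁴` are round) and every shooting experiment (§8, gen 2)
exclude; an actual violator would have to realise these `(f, R)`-statistics without rotational symmetry.
USE FOR PROVERS (consult-style nudge, not a proof): the moment/LP hierarchy over the joint law of `(f, R, |∇f|² = f − R)` with the
families (Fφ), (Rφ), LSI, stability is a systematic computer-assisted route to statements "`f_max ≤ c ⇒` budget" with LP-dual
CERTIFICATES (a pointwise two-variable polynomial–exponential inequality on `{0 ≤ R ≤ f ≤ c}` + a linear combination of the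
identities); it currently reaches `c ≈ 3.6` and cannot remove the need for SOME sup bound (`F → ∞`: §14's three-atom family).
-/

/-! ## §18 (v9) TYPED PROVER INPUTS: the three M-sized identities behind §17 (targets, not claims)

The LP cartography of §17 needs, beyond the LANDED `∫R dV = 2V` (STUB 3), `∫ f e^{-f} = 2∫e^{-f}` (STUB 7) and CRZ, exactly
three integral facts about a closed normalised shrinker, each of the size and shape of the landed stubs (pointwise identity
(A)/(B) or `Δf = 2 − R`, then `∫ (Δ_f u) e^{-f} dV = 0` / `∫ Δu dV = 0` on the closed `M`). They are recorded here as `Prop`s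
in the crux's vocabulary so that a prover (or the planner of a promoted `VarianceBudget` crux) can pick them up verbatim;
with them `PotentialLeThree` relaxes to `f ≤ 3.6` (numerics), and at `Vol ≤ 100π²` to `f ≤ 8`. Docstrings give the paper proof.
Sanity: each holds (as `0 = 0` / `0 ≤ 0`) at the round model, `weightedDirichlet_round` etc.
-/

/-- **W1 — weighted Dirichlet identity** `∫ |∇f|² e^{-f} dV = ∫ (f − 2)² e^{-f} dV` on a closed normalised shrinker.
PAPER: `Δ_f f := Δf − |∇f|² = (2 − R) − (f − R) = 2 − f`; multiply by `(f − 2)e^{-f}` and integrate, using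
`∫ φ (Δ_f ψ) e^{-f} = −∫ ⟨∇φ, ∇ψ⟩ e^{-f}` on the closed `M`. In LP form (§17): `E[(f − R)e^{-f}] = E[(f − 2)²e^{-f}]`.
Size M (same integration-by-parts engine as STUB 7 `integral_mul_exp_neg_eq_two_mul`). [folklore] -/
def WeightedDirichletIdentity : Prop :=
  ∀ (M : Type) [TopologicalSpace M] [T2Space M] [SecondCountableTopology M]
    [ChartedSpace (EuclideanSpace ℝ (Fin 4)) M] [IsManifold (𝓡 4) ∞ M] [CompactSpace M] [T3Space M]
    [MeasurableSpace M] [BorelSpace M]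
    (g : PseudoRiemannianMetric (𝓡 4) ∞ (EuclideanSpace ℝ (Fin 4)) (TangentSpace (𝓡 4) : M → Type _))
    [g.HasLeviCivita] (f : M → ℝ) (hg : g.IsRiemannian), ContMDiff (𝓡 4) 𝓘(ℝ, ℝ) ∞ f →
    (∀ (x : M) (X Y : TangentSpace (𝓡 4) x), g.ricci x X Y + g.hessian f x X Y = (1 / 2 : ℝ) * g.val x X Y) →
    (∀ x : M, g.scalarCurvature x + g.gradSq f x = f x) →
    ∫ x, g.gradSq f x * Real.exp (-f x) ∂(riemannianMeasure (g.toContMDiffRiemannianMetric hg)) =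
      ∫ x, (f x - 2) ^ 2 * Real.exp (-f x) ∂(riemannianMeasure (g.toContMDiffRiemannianMetric hg))

/-- **W2 — weighted scalar-curvature identity** `∫ R e^{-f} dV = 2 ∫ |Ric|² e^{-f} dV` (hence `≥ ½∫R²e^{-f}` by
`|Ric|² ≥ R²/4`, and `∫(R − R²/2)e^{-f} ≥ 2∫|E|²e^{-f} ≥ ½e^{-sup f}∫(R−2)² dV` = W2′ of §17). PAPER: identity (B) of
STUB 2 reads `Δ_f R = R − 2|Ric|²`; integrate against `e^{-f}dV` on the closed `M` (`∫ (Δ_f R) e^{-f} = 0`). Size M. [folklore] -/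
def WeightedScalarIdentity : Prop :=
  ∀ (M : Type) [TopologicalSpace M] [T2Space M] [SecondCountableTopology M]
    [ChartedSpace (EuclideanSpace ℝ (Fin 4)) M] [IsManifold (𝓡 4) ∞ M] [CompactSpace M] [T3Space M]
    [MeasurableSpace M] [BorelSpace M]
    (g : PseudoRiemannianMetric (𝓡 4) ∞ (EuclideanSpace ℝ (Fin 4)) (TangentSpace (𝓡 4) : M → Type _))
    [g.HasLeviCivita] (f : M → ℝ) (hg : g.IsRiemannian), ContMDiff (𝓡 4) 𝓘(ℝ, ℝ) ∞ f →
    (∀ (x : M) (X Y : TangentSpace (𝓡 4) x), g.ricci x X Y + g.hessian f x X Y = (1 / 2 : ℝ) * g.val x X Y) →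
    (∀ x : M, g.scalarCurvature x + g.gradSq f x = f x) →
    ∫ x, g.scalarCurvature x * Real.exp (-f x) ∂(riemannianMeasure (g.toContMDiffRiemannianMetric hg)) =
      2 * ∫ x, g.normSq x (g.ricci x) * Real.exp (-f x) ∂(riemannianMeasure (g.toContMDiffRiemannianMetric hg))

/-- **U1 — variance–gradient identity** `∫ (R − 2)² dV = ∫ |∇f|² (3 − R) dV` (drefute-g2; in LP form
`E[(R−2)²] = E[(f − R)(3 − R)]`). PAPER: `∫ ΔR dV = 0` is not even needed — from identity (A) `⟨∇R, ∇f⟩ = 2Ric(∇f,∇f)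
= |∇f|² − ⟨∇f, ∇|∇f|²⟩` and `∫⟨∇f,∇|∇f|²⟩ = −∫|∇f|²Δf = −∫|∇f|²(2 − R)` one gets `∫⟨∇R,∇f⟩ = ∫|∇f|²(3 − R)`, while
`∫⟨∇R,∇f⟩ = −∫RΔf = ∫R(R − 2) = ∫R² − 4V = ∫(R−2)²` (`∫R = 2V`). Size M (STUB 3's engine). [folklore] -/
def VarianceGradientIdentity : Prop :=
  ∀ (M : Type) [TopologicalSpace M] [T2Space M] [SecondCountableTopology M]
    [ChartedSpace (EuclideanSpace ℝ (Fin 4)) M] [IsManifold (𝓡 4) ∞ M] [CompactSpace M] [T3Space M]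
    [MeasurableSpace M] [BorelSpace M]
    (g : PseudoRiemannianMetric (𝓡 4) ∞ (EuclideanSpace ℝ (Fin 4)) (TangentSpace (𝓡 4) : M → Type _))
    [g.HasLeviCivita] (f : M → ℝ) (hg : g.IsRiemannian), ContMDiff (𝓡 4) 𝓘(ℝ, ℝ) ∞ f →
    (∀ (x : M) (X Y : TangentSpace (𝓡 4) x), g.ricci x X Y + g.hessian f x X Y = (1 / 2 : ℝ) * g.val x X Y) →
    (∀ x : M, g.scalarCurvature x + g.gradSq f x = f x) →
    ∫ x, (g.scalarCurvature x - 2) ^ 2 ∂(riemannianMeasure (g.toContMDiffRiemannianMetric hg)) =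
      ∫ x, g.gradSq f x * (3 - g.scalarCurvature x) ∂(riemannianMeasure (g.toContMDiffRiemannianMetric hg))

/-- Sanity at the round model: W1 holds on `(S⁴(√6), f ≡ 2)` as `∫0 = ∫0`. [folklore] -/
theorem weightedDirichlet_round :
    ∫ x, shrinkingSphereFourMetric.gradSq (fun _ ↦ (2 : ℝ)) x * Real.exp (-(2 : ℝ))
        ∂(riemannianMeasure (shrinkingSphereFourMetric.toContMDiffRiemannianMetric isRiemannian_shrinkingSphereFourMetric)) =
      ∫ x, ((fun _ ↦ (2 : ℝ)) x - 2) ^ 2 * Real.exp (-(2 : ℝ))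
        ∂(riemannianMeasure (shrinkingSphereFourMetric.toContMDiffRiemannianMetric isRiemannian_shrinkingSphereFourMetric)) := by
  simp [gradSq_const]

/-- Sanity at the round model: U1 holds on `S⁴(√6)` as `∫0 = ∫0` (`R ≡ 2`, `∇f = 0`). [folklore] -/
theorem varianceGradient_round :
    ∫ x, (shrinkingSphereFourMetric.scalarCurvature x - 2) ^ 2
        ∂(riemannianMeasure (shrinkingSphereFourMetric.toContMDiffRiemannianMetric isRiemannian_shrinkingSphereFourMetric)) =
      ∫ x, shrinkingSphereFourMetric.gradSq (fun _ ↦ (2 : ℝ)) x * (3 - shrinkingSphereFourMetric.scalarCurvature x)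
        ∂(riemannianMeasure (shrinkingSphereFourMetric.toContMDiffRiemannianMetric isRiemannian_shrinkingSphereFourMetric)) := by
  simp [gradSq_const, scalarCurvature_shrinkingSphereFourMetric]


/-! ## §19 (v10, gen 5) The two forms of STUB 7 part ways off the closed world: `f ≤ 3` is false, `R ≤ 3` reduces to the sibling crux

STUB 7 of the picked skeleton (`stub_potentialLeThree`, v8) asks `f ≤ 3` pointwise for the crux data; its docstring notes
`R_max = f_max`. On a CLOSED manifold the two sup bounds are the same statement — kernel-checked below
(`forall_scalarCurvature_le_iff_forall_potential_le`: at a maximum point `x₀` of `f`, `df(x₀) = 0`, so `|∇f|²(x₀) = 0` and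
`f ≤ f(x₀) = R(x₀)`; conversely `R = f − |∇f|² ≤ f`), hence `potentialLeThree_iff_scalarLeThree` for the crux's own
binder block. But transplanted to the binder block of the sibling crux `NoncompactShrinkerGap` (connected, non-compact,
complete, density kept) they separate sharply:
* `potentialLeThreeNoncompact_false` — the `f`-form is FALSE there (Gaussian shrinker, `f(4e₀) = 4`; `f` is proper on every
  non-compact shrinker, Cao–Zhou 2010), exactly as without closedness at all (§11, p71580);
* `scalarLeThreeNoncompact_of_noncompactShrinkerGap` — the `R`-form FOLLOWS from the sibling crux: a dense
  (`∫e^{-f} > 32π²√π e^{-3/2}`) complete non-compact normalised shrinker has `R ≡ 0` by `NoncompactShrinkerGap`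
  (`scalarCurvature_eq_zero_of_noncompactShrinkerGap`), in particular `R ≤ 3`; and on the known dense non-compact models
  it holds with room (`R ≡ 0` Gaussian, `R ≡ 3/2` on `S³(2)×ℝ`, `R ≡ 1` on `S²×ℝ²` which is below the bar anyway).
So the robust typing of the CRZ sub-line's transfer target is `ScalarLeThree` (`R ≤ 3`): the same content on closed `M`,
but a statement whose every known dense instance — compact or not — is true, and whose non-compact case is literally a
corollary of route item stmt-10868. RECOMMENDATION to the lead/planner (no skeleton is edited here): register the sup
bound as `∀ x, g.scalarCurvature x ≤ 3` (the `f`-form then follows by `forall_scalarCurvature_le_iff_forall_potential_le`).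
Calibration of the constant against ALL known compact examples is corrected in §20: the record `R_max` among smooth
compact 4-d shrinkers is `2.8695` (Wang–Zhu on `ℂP²#2(−ℂP²)`), not Koiso–Cao's `2.5276`.
-/

/-- **`sup R = sup f` on a closed normalised shrinker** (the only input is `R + |∇f|²_g = f` with `g` Riemannian and
`f` continuous on a compact non-empty manifold): `R ≤ c` everywhere iff `f ≤ c` everywhere. (→): at a maximum point
`x₀` of `f` (compactness) Fermat gives `df(x₀) = 0` (`mvfderiv_eq_zero_of_isMaxOn`), so `|∇f|²(x₀) = 0` and
`f ≤ f(x₀) = R(x₀) ≤ c`; (←): `R = f − |∇f|² ≤ f` (`gradSq_nonneg`). [cite: ChengRibeiroZhou2022, Rem. 1] -/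
theorem forall_scalarCurvature_le_iff_forall_potential_le
    {M : Type} [TopologicalSpace M] [ChartedSpace (EuclideanSpace ℝ (Fin 4)) M]
    [IsManifold (𝓡 4) ∞ M] [CompactSpace M] [Nonempty M]
    (g : PseudoRiemannianMetric (𝓡 4) ∞ (EuclideanSpace ℝ (Fin 4)) (TangentSpace (𝓡 4) : M → Type _))
    [g.HasLeviCivita] (f : M → ℝ) (hg : g.IsRiemannian) (hf : Continuous f)
    (hnorm : ∀ x : M, g.scalarCurvature x + g.gradSq f x = f x) (c : ℝ) :
    (∀ x : M, g.scalarCurvature x ≤ c) ↔ (∀ x : M, f x ≤ c) := by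
  constructor
  · intro hR x
    obtain ⟨x₀, -, hmax⟩ := isCompact_univ.exists_isMaxOn univ_nonempty hf.continuousOn
    have hd : mvfderiv (𝓡 4) f x₀ = 0 := mvfderiv_eq_zero_of_isMaxOn hmax
    have h0 : g.gradSq f x₀ = 0 := g.gradSq_eq_zero_of_mvfderiv_eq_zero hd
    have h1 : f x₀ = g.scalarCurvature x₀ := by
      have := hnorm x₀; rw [h0, add_zero] at this; exact this.symm
    calc f x ≤ f x₀ := hmax (mem_univ x)
      _ = g.scalarCurvature x₀ := h1
      _ ≤ c := hR x₀
  · intro hfc x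
    have h := hnorm x
    have hnn := g.gradSq_nonneg hg f x
    linarith [hfc x]

/-- STUB 7 verbatim (`stub_potentialLeThree` of `Lines/cgy-variance-pivot.lean` v8): crux data ⇒ `f ≤ 3`. [folklore] -/
def PotentialLeThree : Prop :=
  ∀ (M : Type) [TopologicalSpace M] [T2Space M] [SecondCountableTopology M]
    [ChartedSpace (EuclideanSpace ℝ (Fin 4)) M] [IsManifold (𝓡 4) ∞ M] [CompactSpace M] [T3Space M]
    [MeasurableSpace M] [BorelSpace M], M ≃ₕ Metric.sphere (0 : EuclideanSpace ℝ (Fin 5)) 1 →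
    ∀ (g : PseudoRiemannianMetric (𝓡 4) ∞ (EuclideanSpace ℝ (Fin 4)) (TangentSpace (𝓡 4) : M → Type _))
      [g.HasLeviCivita] (f : M → ℝ) (hg : g.IsRiemannian), Hyps M g f hg → ∀ x : M, f x ≤ 3

/-- The `R`-form of STUB 7: crux data ⇒ `R ≤ 3`. [folklore] -/
def ScalarLeThree : Prop :=
  ∀ (M : Type) [TopologicalSpace M] [T2Space M] [SecondCountableTopology M]
    [ChartedSpace (EuclideanSpace ℝ (Fin 4)) M] [IsManifold (𝓡 4) ∞ M] [CompactSpace M] [T3Space M]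
    [MeasurableSpace M] [BorelSpace M], M ≃ₕ Metric.sphere (0 : EuclideanSpace ℝ (Fin 5)) 1 →
    ∀ (g : PseudoRiemannianMetric (𝓡 4) ∞ (EuclideanSpace ℝ (Fin 4)) (TangentSpace (𝓡 4) : M → Type _))
      [g.HasLeviCivita] (f : M → ℝ) (hg : g.IsRiemannian), Hyps M g f hg → ∀ x : M, g.scalarCurvature x ≤ 3

/-- **On the crux's binder block the two forms coincide** (`M ≃ₕ S⁴` is non-empty and closed). [folklore] -/
theorem potentialLeThree_iff_scalarLeThree : PotentialLeThree ↔ ScalarLeThree := by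
  constructor
  · intro h M _ _ _ _ _ _ _ _ _ e g _ f hg H
    obtain ⟨p⟩ : Nonempty SphereFour := inferInstance
    haveI : Nonempty M := ⟨e.invFun p⟩
    exact (forall_scalarCurvature_le_iff_forall_potential_le g f hg H.1.continuous H.2.2.1 3).mpr
      (h M e g f hg H)
  · intro h M _ _ _ _ _ _ _ _ _ e g _ f hg H
    obtain ⟨p⟩ : Nonempty SphereFour := inferInstance
    haveI : Nonempty M := ⟨e.invFun p⟩
    exact (forall_scalarCurvature_le_iff_forall_potential_le g f hg H.1.continuous H.2.2.1 3).mp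
      (h M e g f hg H)

/-- The `f`-form transplanted to the binder block of the sibling crux `NoncompactShrinkerGap` (connected,
non-compact, complete: closed `g`-balls compact; density kept inside `Hyps`). [folklore] -/
def PotentialLeThreeNoncompact : Prop :=
  ∀ (M : Type) [TopologicalSpace M] [T2Space M] [SecondCountableTopology M]
    [ChartedSpace (EuclideanSpace ℝ (Fin 4)) M] [IsManifold (𝓡 4) ∞ M] [ConnectedSpace M] [NoncompactSpace M]
    [T3Space M] [MeasurableSpace M] [BorelSpace M]
    (g : PseudoRiemannianMetric (𝓡 4) ∞ (EuclideanSpace ℝ (Fin 4)) (TangentSpace (𝓡 4) : M → Type _))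
    [g.HasLeviCivita] (f : M → ℝ) (hg : g.IsRiemannian),
    (∀ (x : M) (r : NNReal), IsCompact {y : M | g.edist hg x y ≤ r}) → Hyps M g f hg → ∀ x : M, f x ≤ 3

/-- The `R`-form in the same non-compact binder block. [folklore] -/
def ScalarLeThreeNoncompact : Prop :=
  ∀ (M : Type) [TopologicalSpace M] [T2Space M] [SecondCountableTopology M]
    [ChartedSpace (EuclideanSpace ℝ (Fin 4)) M] [IsManifold (𝓡 4) ∞ M] [ConnectedSpace M] [NoncompactSpace M]
    [T3Space M] [MeasurableSpace M] [BorelSpace M]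
    (g : PseudoRiemannianMetric (𝓡 4) ∞ (EuclideanSpace ℝ (Fin 4)) (TangentSpace (𝓡 4) : M → Type _))
    [g.HasLeviCivita] (f : M → ℝ) (hg : g.IsRiemannian),
    (∀ (x : M) (r : NNReal), IsCompact {y : M | g.edist hg x y ≤ r}) → Hyps M g f hg →
    ∀ x : M, g.scalarCurvature x ≤ 3

/-- **The `f`-form is false off the closed world even with completeness and connectedness** — witness the Gaussian
shrinker (complete: `isCompact_setOf_edist_euclideanMetric_le`; `Θ = 1`; `f(4e₀) = 4 > 3`). [cite: CaoHamiltonIlmanen2004, §4] -/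
theorem potentialLeThreeNoncompact_false : ¬ PotentialLeThreeNoncompact := by
  intro h
  have h4 := h EuclideanFour (euclideanMetric EuclideanFour) gaussianPotential isRiemannian_euclideanMetric
    (isCompact_setOf_edist_euclideanMetric_le) hyps_gaussian (EuclideanSpace.single (0 : Fin 4) (4 : ℝ))
  rw [gaussianPotential_single_four] at h4
  norm_num at h4

/-- **Dense complete non-compact normalised shrinkers are scalar-flat, given the sibling crux**: `NoncompactShrinkerGap`
says non-flat (`R ≢ 0`) ones have `∫e^{-f} ≤ 32π²√π e^{-3/2}`, contradicting the density clause of `Hyps`. [folklore] -/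
theorem scalarCurvature_eq_zero_of_noncompactShrinkerGap (hgap : NoncompactShrinkerGap)
    (M : Type) [TopologicalSpace M] [T2Space M] [SecondCountableTopology M]
    [ChartedSpace (EuclideanSpace ℝ (Fin 4)) M] [IsManifold (𝓡 4) ∞ M] [ConnectedSpace M] [NoncompactSpace M]
    [T3Space M] [MeasurableSpace M] [BorelSpace M]
    (g : PseudoRiemannianMetric (𝓡 4) ∞ (EuclideanSpace ℝ (Fin 4)) (TangentSpace (𝓡 4) : M → Type _))
    [g.HasLeviCivita] (f : M → ℝ) (hg : g.IsRiemannian)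
    (hc : ∀ (x : M) (r : NNReal), IsCompact {y : M | g.edist hg x y ≤ r}) (H : Hyps M g f hg) :
    ∀ x : M, g.scalarCurvature x = 0 := by
  by_contra hne
  push Not at hne
  have hle := hgap M g f hg hc H.1 H.2.1 H.2.2.1 hne
  exact absurd H.2.2.2 (not_lt.mpr hle)

/-- **The `R`-form off the closed world is a corollary of the sibling crux `NoncompactShrinkerGap`** (stmt-10868):
`R ≡ 0 ≤ 3`. So — unlike `f ≤ 3` — `R ≤ 3` has no cheap non-compact refutation; its only open content is the compact
case, i.e. STUB 7 itself. [folklore] -/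
theorem scalarLeThreeNoncompact_of_noncompactShrinkerGap (hgap : NoncompactShrinkerGap) :
    ScalarLeThreeNoncompact := by
  intro M _ _ _ _ _ _ _ _ _ _ g _ f hg hc H x
  rw [scalarCurvature_eq_zero_of_noncompactShrinkerGap hgap M g f hg hc H x]
  norm_num



/-! ## §20 (v10, gen 5) The TORIC laboratory: every toric Kähler–Ricci shrinker surface from its polytope (numerics, pure quadrature; folder `toric/`)

METHOD (no PDE is solved). For a toric shrinking Kähler–Ricci soliton (orbifold) surface the volume law of the
potential is polytope data: in moment coordinates `x` on the anticanonical (labelled) polygon `P = {⟨v_a, x⟩ ≥ −1}`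
(`v_a ∈ ℤ²`, label = `gcd`; vertex group order `|det(v_a, v_b)|`), `dV = 16π² dx` (`V = 8π²c₁² = 16π²·Area P` in the crux
normalisation `Ric + Hess f = g/2`), the potential is AFFINE, `f = 2 + ⟨c, x⟩`, where `c` is the unique critical point of the
weighted volume `F(c) = ∫_P e^{-⟨c,x⟩} dx` (zero of the `e^{-⟨c,x⟩}dx`-barycentre; Wang–Zhu 2004 for smooth Fano, Shi–Zhu /
Legendre for labelled polytopes, Conlon–Deruelle–Sun and Cifarelli arXiv:2010.00166 for the non-compact AC case), the additive
constant `2` being forced by `∫(f − 2)e^{-f} = 0` (`Δ_f f = 2 − f`) and the vanishing barycentre; hence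
`Θ = e^{-2} F(c)`, `f_max/min = 2 + max/min_P ⟨c, x⟩` (so `R_max = f_max` on the closed ones, §19), `E_dV f = 2 + ⟨c, centroid⟩`.
VALIDATION (five independent checks, all digits shown agree): Koiso–Cao comes out as `c = (0, −0.5276195)`, `Θ = 0.517868`,
`f ∈ [1.47238, 2.52762]`, `V = 64π²` — identical to gen 2/3's ODE quadrature of Donovan's closed form (§9, §13); Headrick–Wiseman's
`Θ(Wang–Zhu) = 0.45485 = 3.3609/e²` (arXiv:0706.2329 §3, computed by them the same way) is reproduced as `0.454854 = 3.36094/e²`;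
the Gaussian `ℂ²` gives `c = (1,1)`, `f = 2 + x₁ + x₂`, `f_min = 0` at the vertex, `Θ = 1.000000`; the cylinder `ℂ×ℙ¹ = ℝ²×S²`
gives `Θ = 0.735759 = 2/e`; FIK on `Bl₀ℂ² = O(−1)` gives `c = (√2, √2)`, `Θ = 0.671958` (CHI table: `.672`); and the members
`(n,q₁,q₂) = (1,2,1), (2,2,1)` of Donovan's U(2) orbifold family (§11, gen 3: `f_max = 3.91, 4.39`) reappear as labelled
trapezoids with `f_max = 3.9110, 4.3911`.

RESULTS.
* NEW DATUM, corrects §9/§11 and the skeleton's STUB 7 docstring ("every known compact 4-d shrinker has `f_max ≤ 2.53`"):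
  the Wang–Zhu soliton on `ℂP²#2(−ℂP²)` has `f_max = R_max = 2.8695`, `f_min = 1.5653`, `osc f = 1.3042`, `V = 56π²`,
  `Z = 71.83`, `Θ = .4549`, `E_dV f − 2 = (1/V)∫|∇f|² dV = 0.0828`. So the constant `3` of `PotentialLeThree`/`ScalarLeThree`
  clears the smooth compact zoo by `0.13` only (Koiso–Cao: `0.47`), and the CRZ ceiling `3.0807` by `0.21`. (Wang–Zhu is sparse,
  `Θ = .455 < .791`: no conflict with STUB 7, whose hypothesis is the density.)
* STUB 1 ON THE SECOND NON-EINSTEIN SMOOTH EXAMPLE (polytope data + the landed identity U1 = `stub_variance_eq_gradSq_mul`,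
  `D = ∫|∇f|²(3 − R) ≤ 3∫|∇f|² = 3(E_dV f − 2)V`): Wang–Zhu has `D ≤ 137.3 < 2V − 96π² = 157.9` — the variance budget HOLDS on it
  (Koiso–Cao: `D = 58.3 ≤ 166.6 < 315.8`); for the three KE toric del Pezzos `D = 0` (dP₃ sits exactly on the budget line, §12).
  So every smooth compact 4-d shrinker with a known metric or polytope satisfies STUB 1's inequality, dense or not, except the
  `V ≤ 48π²` Einstein ones of §12.
* THE WHOLE TORIC ORBIFOLD ZOO (`toric/scan.py`; 6429 distinct labelled Fano polygons: all normal sets with `‖v‖_∞ ≤ 2` and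
  `≤ 6` facets, `‖v‖_∞ ≤ 3` and `≤ 4` facets; each carries a toric shrinking KRS orbifold metric): smooth members = exactly the five
  toric del Pezzos (`Θ = .6090, .5413, .5179, .4549, .4060`); EVERY orbifold member obeys `Θ ≤ 1/|Γ_max|` (the §10 bound, 0 violations;
  global toric quotients show `Θ(M/ℤ_k) = Θ(M)/k` to all digits); `f_max = R_max > 3` for 5262/6429 (up to `28.7`), the densest of them
  being the soliton on `ℂP²_{(1,1,2)}` with `Θ = .4304`, `f_max = 3.344` (gen 3's envelope "`Θ ≤ .34` once `f_max ≥ 2.6`", read off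
  Donovan's sub-family, is superseded: `.455` at `2.87` smooth, `.430` at `3.34` orbifold); upper envelope `Θ_max(f_max)`:
  `.609 (2) / .455 (2.87) / .430 (3.3) / .351 (4.5) / .296 (5.1) / .241 (6) / .198 (8) / .151 (10) / .076 (20)` — monotonically sparser
  with growing `R_max`, and nothing toric within a factor `1.3` of the bar `.791`.
* NON-COMPACT (sibling crux `NoncompactShrinkerGap`, stmt-10868, whose filed risk is "BCCD 2024 (density never computed) may have
  `Θ ∈ (.791, 1)`"): the Bamler–Cifarelli–Conlon–Deruelle shrinker on `Bl_p(ℂ×ℙ¹)` (arXiv:2206.10785; toric, cohomogeneity two,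
  asymptotic to `ℂ×ℙ¹`; it completes the classification of complete shrinking KÄHLER–Ricci soliton surfaces: `ℂ², ℂ×ℙ¹`, FIK, BCCD,
  del Pezzos, quotients) has, by the same validated recipe (`toric/noncompact.py`, `c = (1.28760, 0.64380) = (2t*, t*)`; CLOSED FORM:
  `F(t) = (e^{2t} − e^{t})/t²`, `e^{t*}(2 − 2t*) = 2 − t*`, and for FIK `F(s) = e^{s}(s+1)/s²`, `s* = √2`, `Θ(FIK) = (1+√2)e^{√2−2}/2`),
      `Θ(BCCD) = e^{-2}F(t*) = 0.5617 = 4.151/e²`   (`f_min = 0.712`; kernel-checked bound `bccd_density_lt_bar`: `≤ .579 < .791`),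
  far below the bar — so EVERY Kähler shrinker in real dimension four now has a computed density, none in `(.791, 1)`:
  `1, .736, .672, .562` non-compact; `≤ .609` compact. (A hypothetical toric shrinker on `Bl_{2}(ℂ×ℙ¹)` would have `Θ = .418`.)
  This removes the one named candidate against stmt-10868; it does not bear on the present crux except through the rung.
-/

/-- **`Θ(FIK) < Θ(S³×ℝ)`, kernel-checked one-point bound.** PAPER (§20): for the Feldman–Ilmanen–Knopf shrinker on
`Bl₀ℂ²` the anticanonical polyhedron is `P = {x₁ ≥ −1, x₂ ≥ −1, x₁ + x₂ ≥ −1}`, the soliton vector is the minimiser of the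
weighted volume `F(c) = ∫_P e^{-⟨c,x⟩}dx` (Conlon–Deruelle–Sun; Cifarelli arXiv:2010.00166), by symmetry `c = (s,s)` with
`F(s) = e^{s}(s+1)/s²`, minimised at `s = √2`: `Θ(FIK) = e^{-2} min F = (1+√2)e^{√2−2}/2 = 0.671958` (CHI table `.672`).
LEAN: the one-point bound `Θ(FIK) ≤ e^{-2}F(3/2) = (10/9)e^{-1/2} = .674 < 2√π e^{-3/2} = .791` (`⟸ 10e/9 < 2√π`). [cite: CaoHamiltonIlmanen2004, §4] -/
theorem fik_density_lt_bar :
    Real.exp (-2) * (Real.exp (3 / 2) * (3 / 2 + 1) / (3 / 2) ^ 2) < 2 * Real.sqrt Real.pi * Real.exp (-(3 : ℝ) / 2) := by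
  have hπ := Real.pi_pos
  have hs : (1.77 : ℝ) < Real.sqrt Real.pi := by
    rw [Real.lt_sqrt (by norm_num)]
    have := Real.pi_gt_d6; nlinarith
  have he1 : Real.exp 1 < 2.7182818286 := Real.exp_one_lt_d9
  have hE : Real.exp (-2) * Real.exp (3 / 2) = Real.exp (-(3 : ℝ) / 2) * Real.exp 1 := by
    rw [← Real.exp_add, ← Real.exp_add]; norm_num
  have h32 := Real.exp_pos (-(3 : ℝ) / 2)
  have key : Real.exp (-2) * (Real.exp (3 / 2) * (3 / 2 + 1) / (3 / 2) ^ 2)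
      = Real.exp (-(3 : ℝ) / 2) * (10 / 9 * Real.exp 1) := by
    rw [show Real.exp (-2) * (Real.exp (3 / 2) * (3 / 2 + 1) / (3 / 2) ^ 2)
        = (Real.exp (-2) * Real.exp (3 / 2)) * (10 / 9) by ring, hE]; ring
  rw [key]
  calc Real.exp (-(3 : ℝ) / 2) * (10 / 9 * Real.exp 1)
      < Real.exp (-(3 : ℝ) / 2) * (2 * Real.sqrt Real.pi) := by
        apply mul_lt_mul_of_pos_left _ h32; nlinarith
    _ = 2 * Real.sqrt Real.pi * Real.exp (-(3 : ℝ) / 2) := by ring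

/-- **`Θ(BCCD) < Θ(S³×ℝ)` — the Bamler–Cifarelli–Conlon–Deruelle shrinker is sparse; kernel-checked one-point bound.**
PAPER (§20): for the toric shrinker on `Bl_p(ℂ×ℙ¹)` (arXiv:2206.10785, unique by Cifarelli) the polyhedron is
`P = {x₁ ≥ −1, |x₂| ≤ 1, x₁ + x₂ ≥ −1}`; the unimodular involution `(x₁,x₂) ↦ (x₁+x₂, −x₂)` of `P` forces `c = (2t, t)`, and
`F(t) = ∫_P e^{-t(2x₁+x₂)}dx = (e^{2t} − e^{t})/t²`, minimised where `e^{t}(2 − 2t) = 2 − t`, `t* = 0.6437978`: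
`Θ(BCCD) = e^{-2}F(t*) = 4.1507/e² = 0.561737` (`f_min = 2 − 2t* = 0.712` at the vertex `(−1,0)`). So the density that the
sibling crux stmt-10868 lists as "never computed, may lie in `(.791, 1)`" is `0.562`. LEAN: since `Θ = e^{-2} min_t F(t) ≤ e^{-2}F(1/2)
= 4(e^{-1} − e^{-3/2}) = .579`, it suffices that `4(e^{-1} − e^{-3/2}) < 2√π e^{-3/2}`, i.e. `4(e^{1/2} − 1) < 2√π`. [cite: CaoHamiltonIlmanen2004, §4] -/
theorem bccd_density_lt_bar :
    Real.exp (-2) * (4 * (Real.exp 1 - Real.exp (1 / 2))) < 2 * Real.sqrt Real.pi * Real.exp (-(3 : ℝ) / 2) := by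
  have hπ := Real.pi_pos
  have hs : (1.77 : ℝ) < Real.sqrt Real.pi := by
    rw [Real.lt_sqrt (by norm_num)]
    have := Real.pi_gt_d6; nlinarith
  have he1 : Real.exp 1 < 2.7182818286 := Real.exp_one_lt_d9
  have hE2 : Real.exp (-2) = Real.exp (-(3 : ℝ) / 2) * Real.exp (-(1 / 2)) := by rw [← Real.exp_add]; norm_num
  have hE1 : Real.exp 1 = Real.exp (1 / 2) * Real.exp (1 / 2) := by rw [← Real.exp_add]; norm_num
  have hinv : Real.exp (-(1 / 2 : ℝ)) * Real.exp (1 / 2) = 1 := by rw [← Real.exp_add]; norm_num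
  have h32 := Real.exp_pos (-(3 : ℝ) / 2)
  rw [hE2, hE1]
  have key : Real.exp (-(1 / 2 : ℝ)) * (4 * (Real.exp (1 / 2) * Real.exp (1 / 2) - Real.exp (1 / 2)))
      = 4 * (Real.exp (1 / 2) - 1) := by
    have : Real.exp (-(1 / 2 : ℝ)) * (4 * (Real.exp (1 / 2) * Real.exp (1 / 2) - Real.exp (1 / 2)))
        = 4 * (Real.exp (-(1 / 2 : ℝ)) * Real.exp (1 / 2)) * (Real.exp (1 / 2) - 1) := by ring
    rw [this, hinv]; ring
  have hup : Real.exp (1 / 2) < 1.6488 := by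
    have h2 : Real.exp (1 / 2) ^ 2 < (1.6488 : ℝ) ^ 2 := by
      rw [← Real.exp_nat_mul]; norm_num
      linarith
    exact lt_of_pow_lt_pow_left₀ 2 (by norm_num) h2
  calc Real.exp (-(3 : ℝ) / 2) * Real.exp (-(1 / 2)) * (4 * (Real.exp (1 / 2) * Real.exp (1 / 2) - Real.exp (1 / 2)))
      = Real.exp (-(3 : ℝ) / 2) * (4 * (Real.exp (1 / 2) - 1)) := by rw [mul_assoc, key]
    _ < Real.exp (-(3 : ℝ) / 2) * (2 * Real.sqrt Real.pi) := by
        apply mul_lt_mul_of_pos_left _ h32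
        nlinarith
    _ = 2 * Real.sqrt Real.pi * Real.exp (-(3 : ℝ) / 2) := by ring

/-! ## §21 (v10, gen 5) Structure note for provers: what the `f`-test-function hierarchy can and cannot give (paper)

Testing `Δ_f f = 2 − f` (equivalently `Δf = 2 − R`) against ALL functions of `f` on a closed normalised shrinker is ONE family, and
it collapses to a statement about two one-variable functions: with `ρ` the `dV/V`-law of `f` and `p(t) := E_dV[R | f = t]`,
    `(p(t) − 2)ρ(t) = −(d/dt)[(t − p(t))ρ(t)]`,  i.e.  `E[|∇f|² | f = t]·ρ(t) = e^{t}∫_{f_min}^{t}(2 − s)e^{-s}ρ(s) ds =: e^{t}a(t)`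
(coarea form of `∫_{f<t}Δ_f f e^{-f} = −∫_{f=t}|∇f|e^{-f}`; boundary terms vanish since `|∇f|² → 0` at the extremes; `a(f_max) = 0` is
`∫(f−2)e^{-f} = 0`, and `∫R = 2V` follows). CONSEQUENCES. (i) The law `ρ` of `f` alone DETERMINES the level-set means of `R`:
`p(t) = t − e^{t}a(t)/ρ(t)`; positivity `R > 0` becomes the pointwise constraint `e^{t}a(t) < tρ(t)` — in particular `ρ` has NO GAPS:
wherever the partial weighted moment `a(t)` is non-zero the law of `f` must carry density `ρ(t) ≥ e^{t}a(t)/t` (a hot region `f ≈ F`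
of `dV`-mass `m` forces a ramp of comparable mass `≈ m(F−2)e^{t−F}/t` below it, on which `R ≈ 0`: Gaussian-shell geometry again, §15).
(ii) Given `ρ`, the maximum of `D/V = E[(R−2)²]` over all joint laws compatible with the family and `0 ≤ R ≤ f` is attained by two-valued
`R ∈ {0, t}` on each level and equals `4 + ∫p(t)(t − 4)ρ = 3(E_dV f − 2) = (3/V)∫|∇f|² dV` — which is exactly the landed U1 bound
`D = ∫|∇f|²(3 − R) ≤ 3∫|∇f|²` (so the skeleton's `compactShrinkerGap_of_dirichletEnergy_lt`, budget ⇐ `E_dV f < 8/3 − 32π²/V`, is the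
OPTIMAL output of this family). (iii) Hence the family + `R > 0` + density cannot bound `D` without a sup bound: with Gaussian mass
pinned (`E[e^{-f}] ≥ (1−ε)e^{-2}`) one still has laws with `E_dV f − 2 ≈ ε(F − 2) → ∞` as `F = f_max → ∞` (continuous version of §14's
atoms, ramp included), while for `f_max ≤ F` it gives `D/V ≤ 3ε(F − 2) + O(√ε)`, i.e. the budget for `F ≲ 2 + β/(3ε)` (`≈ 23` at
`V = 95π²`; cf. §17's "F* = ∞ for V ≤ 96π²" within the scanned range). (iv) What lies beyond this family: test functions of `(f, R)`
(U1 is `φ = R`), the `Δ_f R = R − 2|Ric|²` family (which brings in the free level functions `E[|Ric|² | f]`, `E[Ric(∇f,∇f) | f]`,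
constrained only by `|Ric|² ≥ R²/4` and `|Ric(∇f,∇f)| ≤ |Ric||∇f|²`; with `φ ≡ 1` it is W2, with indicators it is CRZ), LSI-minimality
and second variation (§17). The LP of §17 is a finite section of this; its dip `F* ≈ 3.6` is therefore a statement about the
`R`-family + CRZ, not about the `f`-family, which is exhausted by U1.
-/

end Summit.SmoothPoincare4.SmoothPoincare4.Cruxes.CompactShrinkerGap.Disproof

end
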